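import Literature.MathematicalPhysics.QuantumFieldTheory.Balaban1983to89.Node00.OpsYSectDQ
import Literature.MathematicalPhysics.QuantumFieldTheory.Balaban1983to89.Node00.OpsYQLetter
import Literature.MathematicalPhysics.QuantumFieldTheory.Balaban1983to89.B9Thm315SectEStarRepAtLettersR

/-!
# `Balaban1983to89.Node00.OpsYRecordV10` — [Balaban1985BackgroundPropagators] def-Y's OPERATOR LAYER OF RECORD OVER A GENERIC AVERAGING PAIR `(𝔮, 𝔮⋆)`:
# the two STAR instances `opsYStOfRecordV10E ∕ opsYNuStOfRecordV10E N θ M⋆ 𝔮 𝔮⋆ h𝔮 h𝔮⋆ 𝔯 𝔢 𝔴 𝔈` at the v10 letters of record `lettersYOfRecordV10`, their `rfl`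
# faces, the symmetric ∕ unit faces of Sect. D's `G̃ ∕ G₁ ∕ (𝔮G₁𝔮⋆)⁻¹ ∕ 𝔊` over an ADJOINT pair, row 24 (`t315`) keyed by name — and ★ THE KNIT PAIR OF RECORD
# `(qKnitOfRecord, qsKnitOfRecord)` (print's `Q` of (3.115)) with its letters ∕ instances `lettersYOfRecordV10K ∕ opsYStOfRecordV10KE ∕ opsYNuStOfRecordV10KE`

T. Bałaban, *Propagators for lattice gauge theories in a background field*, Commun. Math. Phys. **99** (1985) 389–434 [`Balaban1985BackgroundPropagators`];
T. Bałaban, *Averaging operations for lattice gauge theories*, Commun. Math. Phys. **98** (1985) 17–51 [`Balaban1985Averaging`].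

WHAT THIS FILE IS.  The v ≤ 9 records of def-Y's operator layer (`opsYStOfRecordV4PE ∕ opsYNuStOfRecordV4PE`, `Node00.OpsYSectEStarRecordP`) hard-wire the
STRAIGHT-CONTOUR averaging pair `Q(U) = QY parBY`, `Q*(U) = QsY parBY` of (3.12)–(3.13) into the nine `Q`-dependent letters (`Δ_a, G` (3.26)–(3.27); `G̃, (QG̃Q*)⁻¹, H`
(3.122)–(3.126); `G₁, (QG₁Q*)⁻¹, H₁` (3.128)–(3.132); `𝔊` (3.153)).  Print's `Q` in Sects. D–E is the COMPOSITE averaging `Q(U)` of (3.115) (= [`Balaban1985Averaging`],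
(15)–(23); dag-n06-l's `QknitY`), the letter for which (3.124) `Q(U) D_U G′(U) R(U) = 0` holds.  `Node00.OpsYSectDQ` rebuilt the nine letters over a GENERIC pair
`(𝔮, 𝔮⋆)` and filed the v10 letters of record `lettersYOfRecordV10 N θ M⋆ 𝔮 𝔮⋆ h𝔮 h𝔮⋆ 𝔯`; `Node00.OpsYQLetter` filed the regime laws of a pair and the two families
of record (`qYOfRecord ∕ qsYOfRecord` straight, `qKnitOfRecord ∕ qsKnitOfRecord` knit).  THIS FILE is the operator layer over them:

* §1 (one index `i`, `𝔸 = M_N(ℂ)`, a pair `(𝔮, 𝔮⋆)` ADJOINT at the configuration: `IsAdjTr 1 1 (𝔮 U) (𝔮⋆ U)`): `𝔮⋆a𝔮`, `Δ_a[𝔮]` (3.26), `G[𝔮]` (3.27), `G̃⁻¹[𝔮]`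
  (3.122), `G̃`, `𝔮G̃𝔮⋆`, `(𝔮G̃𝔮⋆)⁻¹` (3.123), `G₁⁻¹` (3.128), `G₁`, `(𝔮G₁𝔮⋆)⁻¹` (3.132), `𝔊` (3.153) are `trIP`-SYMMETRIC at `G`-valued data, `G ≤ U(N)` — the
  twins of `Node00.OpsYSectDESymm`'s engine with the transporter hypothesis `hparB` REPLACED by the displayed adjointness `hQ`; `𝔮𝒢𝔮⋆ > 0` and ★ `IsUnit (𝔮G₁𝔮⋆)(U)`
  from `Δ⁽¹⁾(U) > 0`, the adjointness and `𝔮⋆(U)` injective — with `injective_of_isAdjTr_of_surjective` (THE ADJOINT OF AN ONTO LETTER IS INJECTIVE) the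
  certificate's `hUQ` follows from (L2) onto-ness; the same at def-Y's symmetrised tables `parSymY ∕ GpPhysY (parSymY)`; `G[𝔮]` fed `G′_phys` = fed `G′_latt`.
* §2 the v10 LETTERS OF RECORD by name: `_base` (rows 4–12's letters = v4P's, `rfl`), `_sectDE` (the seven composites + `GA` as `…QY` objects, `rfl`), `_GA_phys`,
  ★ `lettersYOfRecordV10_symmDG₁GG` (the certificate's `hsymD`: `GD ∧ G₁ ∧ GG` symmetric at special-unitary configurations, from the pair's adjointness THERE and a
  symmetric residual letter), `_isUnit_QGQOfQY_G₁` (+ `_of_surjective`); at the straight pair of record the v10 record IS the v4P record (`lettersYOfRecordV10_qYOfRecord`).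
* §3 ★★★ THE TWO STAR INSTANCES `opsYStOfRecordV10E ∕ opsYNuStOfRecordV10E … := opsYSectESt … (opsYS349[Nu]OfLetters … 𝔏 𝔈) 𝔏 𝔢 𝔴` at `𝔏 := lettersYOfRecordV10 …`
  — exactly the shape of `opsYStOfRecordV4PE ∕ opsYNuStOfRecordV4PE`, which they ARE at the straight pair (`_QY`, `_qYOfRecord`) — with the `rfl` transport a
  certificate needs: `_apply`, `_letters` (vs def-Y's base readings `opsYOfLetters` of the v10 letters), `_QGQinv_QG1Qinv` (row 26's kernels = the `ν`-readings
  of `(𝔮G̃𝔮⋆)⁻¹ ∕ (𝔮G₁𝔮⋆)⁻¹` FED `G′_phys`), `_sectE` (row 24 reads the STAR `C^{(k)}(Λ; U) = CkStY` over the v10 letters, whose `δK` (3.157) carries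
  `(𝔮G₁𝔮⋆)⁻¹`), `_Ck_ker`, `_preds`, `Y9OfRecord_…`, `_Ck_ker_flat`, `t315_…_iff` (`Iff.rfl`), `t315_…_flat`, and ★ ROW 24 KEYED BY NAME
  `t315_opsYNuStOfRecordV10E_sectEStYOfRecordV7_of_3185_on[R] ∕ t315_opsYStOfRecordV10E_sectEStYOfRecordV7_of_3185_onR` (one-line instances of
  `B9Thm315SectEStarRepAtLettersR` §5).
* §4 ★ THE KNIT PAIR OF RECORD: `qsKnitOfRecord_one_eq` (the `U = 1` clause of the knit adjoint family, `adjTrY (Q(1)) = lift q*`, from `qKnitOfRecord_one_eq`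
  and `adjTrY_QY_parBY`), `isAdjTr_qKnitOfRecord` (adjoint at EVERY configuration, by construction), the DEFINITIONS `lettersYOfRecordV10K ∕ opsYStOfRecordV10KE ∕
  opsYNuStOfRecordV10KE N θ M⋆ 𝔯 …` := the v10 objects at `(qKnitOfRecord, qsKnitOfRecord, qKnitOfRecord_flat, qsKnitOfRecord_flat)` (`_eq`, `rfl`: every §2–§3
  face applies after one rewrite), their by-name faces `_base ∕ _sectDE ∕ _GA_phys`, ★ `lettersYOfRecordV10K_symmDG₁GG` with the adjointness DISCHARGED,
  `_isUnit_QGQOfQY_G₁` from `Δ⁽¹⁾ > 0` and `Q(U)` onto (`IsOntoOnQ`), the bundles, and row 24 keyed `t315_opsYNuStOfRecordV10KE_sectEStYOfRecordV7_of_3185_on[R] ∕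
  t315_opsYStOfRecordV10KE_sectEStYOfRecordV7_of_3185_onR`.

HONEST SCOPE.  Definitions, `rfl` bookkeeping and finite-dimensional linear algebra (adjoint sandwiches; `Ring.inverse` of symmetric ∕ positive operators); no
inequality of the paper is proved or asserted.  The (3.124) law, onto-ness and the size bounds of the pair are NOT used by the constructions (they are displayed
hypotheses of the (3.151)∕(3.152) readers and of the certificate); the star (3.185) slot `rhs3185stY` of `Node00.OpsYSectEStar` keeps its straight-contour
middle factor `QY parBY · Γ̃⁽²⁾ · QsY parBY` (re-keying it to `𝔮` is a separate star edition).  Nothing landed is modified; N06 ∕ N08 are NOT discharged; NOT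
continuum, NOT OS, NOT the mass gap.  Filed by the pub-ymgap def-Y owner lineage (`pub-ymgap-node00-def-Y`, gen 32).  Net new unproved facts: 0.
-/

noncomputable section

namespace Literature.MathematicalPhysics.QuantumFieldTheory.Balaban1983to89.Node00

open B6KLevelCensusIndexV1 (KIdx)
open B9PinMembersKLevelV1 (MemberY geo9Y bg9Y)
open B9PinCarriersKLevelV1 (carriersY)
open B9PinGeometryKLevelV1 (inΛY unitDistY c35Y)
open B9BackgroundsKLevelV1R (RegFamY bg9YR siteKernelR MemOfFam)
open B7Prop2SpecialUnitary (specialUnitaryUnits specialUnitaryUnits_le_unitaryUnits)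
open B9Thm311ReadingCoords (trIP trIP_zero_right IsSymmTr IsAdjTr PosDefTr isUnit_of_posDefTr)
open B9Thm311DeltaPrimePos (trIP_self_pos posDefTr_ringInverse)
open B9Thm311DeltaPrimeSymm (isSymmTr_add)
open B9Thm311InputsAtOne (isSymmTr_liftOpY)
open B9Thm311AdjointPairs (isAdjTr_reverse isSymmTr_sandwich_of_isAdjTr isSymmTr_sub gradY_RY_divY_isSymmTr aK_isSymm)
open B9Ineq349SiteAdjoint (isSymmTr_ringInverse)
open B9Ineq349SiteReading (p349SiteY fineKernelOfSiteOp opsYS349OfLetters)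
open B9Eq3132NuReading (siteKernelOfOpNu nuY opsYS349NuOfLetters)
open B9Thm315SectEStarRepAtLettersR (DecayMidOnStY t315_opsYSectESt_sectEStYOfRecordV7_of_3185_on
  t315_opsYSectESt_sectEStYOfRecordV7_of_3185_onR)
open OpsYQLetter (QLetterY QsLetterY RegimeY QFamY QsFamY adjTrY isAdjTr_adjTrY adjTrY_QY_parBY IsOntoOnQ qYOfRecord qsYOfRecord qKnitOfRecord
  qsKnitOfRecord qYOfRecord_apply qKnitOfRecord_apply qsKnitOfRecord_apply isFlatQ_qKnitOfRecord qKnitOfRecord_one_eq)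
open scoped Matrix

variable {d ℓ : ℕ} {hd : 1 ≤ d + 1} {hL : Odd (ℓ + 1) ∧ 1 < ℓ + 1} {b₀ b₁ : ℝ} {Mstar : ℕ}

/-! ## §1 Over a generic ADJOINT averaging pair at one index: Sect. B∕D's `Q`-dependent letters symmetric, `(𝔮G₁𝔮⋆)(U)` a unit -/

section SymmQ

open scoped Matrix.Norms.L2Operator

variable {N : ℕ} {S S' : Type} [Fintype S] [Fintype S']

/-- ★ **THE ADJOINT OF AN ONTO LETTER IS INJECTIVE**: if `Q⋆` is the `trIP`-adjoint of `Q` (positive target weights) and `Q` is onto, then `Q⋆` is injective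
(`⟨QΦ, Ψ⟩ = ⟨Φ, Q⋆Ψ⟩`; `Q⋆Ψ = 0`, `Ψ = QΦ` ⇒ `⟨Ψ, Ψ⟩ = 0`) — how (L2) «`Q(U)` onto» feeds the unit `(QG₁Q*)(U)` of (3.132).
[cite: Balaban1985BackgroundPropagators, p.393 (scalar products; Q* the adjoint of Q), (3.132) p.422] [cite: Balaban1985Averaging, (15) p.19] -/
theorem injective_of_isAdjTr_of_surjective {wX : S → ℝ} {wY : S' → ℝ} (hwY : ∀ s, 0 < wY s)
    {Q : (S → Matrix (Fin N) (Fin N) ℂ) →ₗ[ℂ] (S' → Matrix (Fin N) (Fin N) ℂ)} {Qs : (S' → Matrix (Fin N) (Fin N) ℂ) →ₗ[ℂ] (S → Matrix (Fin N) (Fin N) ℂ)}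
    (hQ : IsAdjTr wX wY Q Qs) (hsurj : Function.Surjective Q) : Function.Injective Qs := by
  refine (injective_iff_map_eq_zero Qs).2 fun Ψ hΨ => ?_
  by_contra hne
  obtain ⟨Φ, hΦ⟩ := hsurj Ψ
  have h := hQ Φ Ψ
  rw [hΦ, hΨ, trIP_zero_right] at h
  exact (trIP_self_pos wY hwY hne).ne' h

variable (i : KIdx d ℓ hd hL b₀ b₁) {G : Subgroup (Matrix (Fin N) (Fin N) ℂ)ˣ}
variable (𝔮 : QLetterY (Matrix (Fin N) (Fin N) ℂ) i) (𝔮s : QsLetterY (Matrix (Fin N) (Fin N) ℂ) i) (parS : SiteParY (Matrix (Fin N) (Fin N) ℂ) i)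
  (Gp : SiteOpY (Matrix (Fin N) (Fin N) ℂ) i) (Δ2 : BondOpY (Matrix (Fin N) (Fin N) ℂ) i) (U : CfgY (Matrix (Fin N) (Fin N) ℂ) i)

/-- ★ **`𝔮⋆(U) a 𝔮(U)` IS SYMMETRIC** when `𝔮⋆(U)` is the adjoint of `𝔮(U)` — an adjoint sandwich of the symmetric block weight `a` (3.26).
[cite: Balaban1985BackgroundPropagators, (3.26) p.395, (3.122) p.420, p.393 (Q* the adjoint of Q)] -/
theorem isSymmTr_qs_aY_q (hQ : IsAdjTr (fun _ => (1 : ℝ)) (fun _ => (1 : ℝ)) (𝔮 U) (𝔮s U)) :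
    IsSymmTr (fun _ => (1 : ℝ)) (𝔮s U ∘ₗ aY i ∘ₗ 𝔮 U) :=
  isSymmTr_sandwich_of_isAdjTr hQ (isSymmTr_liftOpY (aK i) (aK_isSymm i))

/-- ★ **`Δ_a[𝔮](U) = Δ(U) + D R D* + 𝔮⋆a𝔮` (3.26) IS SYMMETRIC** at a `G`-valued configuration, `G ≤ U(N)`, for an adjoint pair and symmetric `R(U)` (generic
`parS ∕ Gp`; dag-n06-j's `B9Thm311PosDefAveragingSwap.deltaAQY_isSymmTr` is the instance at `parSymY ∕ GpY (parSymY)`, by name).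
[cite: Balaban1985BackgroundPropagators, (3.26) p.395, (3.10) p.392, (3.20) p.394] -/
theorem deltaAQY_isSymmTr_of_isAdjTr (hG : G ≤ B7Prop2Explicit.unitaryUnits (Matrix (Fin N) (Fin N) ℂ)) (hU : ∀ μ x, U μ x ∈ G)
    (hQ : IsAdjTr (fun _ => (1 : ℝ)) (fun _ => (1 : ℝ)) (𝔮 U) (𝔮s U)) (hR : IsSymmTr (fun _ => (1 : ℝ)) (RY i parS Gp U)) :
    IsSymmTr (fun _ => (1 : ℝ)) (deltaAQY i 𝔮 𝔮s parS Gp U) := by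
  have hU' : ∀ μ x, ((U μ x : (Matrix (Fin N) (Fin N) ℂ)ˣ) : Matrix (Fin N) (Fin N) ℂ) ∈ unitary (Matrix (Fin N) (Fin N) ℂ) :=
    fun μ x => hG (hU μ x)
  rw [deltaAQY]
  exact isSymmTr_add _ (isSymmTr_add _ (hessY_isSymmTr i U hU') (gradY_RY_divY_isSymmTr i parS Gp U hU' hR)) (isSymmTr_qs_aY_q i 𝔮 𝔮s U hQ)

/-- ★ **`G[𝔮](U) = Δ_a[𝔮](U)⁻¹` (3.27) IS SYMMETRIC** at `G`-valued data (invertible or not). [cite: Balaban1985BackgroundPropagators, (3.27) p.395, (3.25) p.394] -/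
theorem GAQY_isSymmTr (hG : G ≤ B7Prop2Explicit.unitaryUnits (Matrix (Fin N) (Fin N) ℂ)) (hU : ∀ μ x, U μ x ∈ G)
    (hQ : IsAdjTr (fun _ => (1 : ℝ)) (fun _ => (1 : ℝ)) (𝔮 U) (𝔮s U)) (hR : IsSymmTr (fun _ => (1 : ℝ)) (RY i parS Gp U)) :
    IsSymmTr (fun _ => (1 : ℝ)) (GAQY i 𝔮 𝔮s parS Gp U) :=
  isSymmTr_ringInverse _ (deltaAQY_isSymmTr_of_isAdjTr i 𝔮 𝔮s parS Gp U hG hU hQ hR)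

/-- ★ **`G̃⁻¹[𝔮](U) = Δ_π + D R D* + 𝔮⋆a𝔮` (3.122) IS SYMMETRIC** at `G`-valued data, `G ≤ U(N)`, for an adjoint pair and symmetric `G′(U)`, `R(U)` —
`deltaPiAY_isSymmTr` with `hparB` replaced by the adjointness `hQ`. [cite: Balaban1985BackgroundPropagators, (3.122) p.420, (3.119) p.419, (3.26) p.395] -/
theorem deltaPiAQY_isSymmTr (hG : G ≤ B7Prop2Explicit.unitaryUnits (Matrix (Fin N) (Fin N) ℂ)) (hU : ∀ μ x, U μ x ∈ G)
    (hQ : IsAdjTr (fun _ => (1 : ℝ)) (fun _ => (1 : ℝ)) (𝔮 U) (𝔮s U)) (hGp : IsSymmTr (fun _ => (1 : ℝ)) (Gp U))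
    (hR : IsSymmTr (fun _ => (1 : ℝ)) (RY i parS Gp U)) : IsSymmTr (fun _ => (1 : ℝ)) (deltaPiAQY i 𝔮 𝔮s parS Gp U) := by
  have hU' : ∀ μ x, ((U μ x : (Matrix (Fin N) (Fin N) ℂ)ˣ) : Matrix (Fin N) (Fin N) ℂ) ∈ unitary (Matrix (Fin N) (Fin N) ℂ) :=
    fun μ x => hG (hU μ x)
  rw [deltaPiAQY]
  exact isSymmTr_add _ (isSymmTr_add _ (deltaPiY_isSymmTr i parS Gp U hU' hGp hR) (gradY_RY_divY_isSymmTr i parS Gp U hU' hR))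
    (isSymmTr_qs_aY_q i 𝔮 𝔮s U hQ)

/-- ★★ **SECT. D's `G̃[𝔮](U) = Ring.inverse G̃⁻¹[𝔮](U)` (3.122)–(3.123) IS SYMMETRIC** at `G`-valued data (invertible or not).
[cite: Balaban1985BackgroundPropagators, (3.122)–(3.123) p.420, Thm 3.12 p.423] -/
theorem GDQY_isSymmTr (hG : G ≤ B7Prop2Explicit.unitaryUnits (Matrix (Fin N) (Fin N) ℂ)) (hU : ∀ μ x, U μ x ∈ G)
    (hQ : IsAdjTr (fun _ => (1 : ℝ)) (fun _ => (1 : ℝ)) (𝔮 U) (𝔮s U)) (hGp : IsSymmTr (fun _ => (1 : ℝ)) (Gp U))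
    (hR : IsSymmTr (fun _ => (1 : ℝ)) (RY i parS Gp U)) : IsSymmTr (fun _ => (1 : ℝ)) (GDQY i 𝔮 𝔮s parS Gp U) :=
  isSymmTr_ringInverse _ (deltaPiAQY_isSymmTr i 𝔮 𝔮s parS Gp U hG hU hQ hGp hR)

/-- `G₁⁻¹[𝔮](U) = G̃⁻¹[𝔮] − Δ⁽²⁾_π` (3.128) IS SYMMETRIC at `G`-valued data when `Δ⁽²⁾(U)` is. [cite: Balaban1985BackgroundPropagators, (3.128) p.421, (3.134)–(3.135) p.422] -/
theorem deltaOneQY_isSymmTr (hG : G ≤ B7Prop2Explicit.unitaryUnits (Matrix (Fin N) (Fin N) ℂ)) (hU : ∀ μ x, U μ x ∈ G)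
    (hQ : IsAdjTr (fun _ => (1 : ℝ)) (fun _ => (1 : ℝ)) (𝔮 U) (𝔮s U)) (hGp : IsSymmTr (fun _ => (1 : ℝ)) (Gp U))
    (hR : IsSymmTr (fun _ => (1 : ℝ)) (RY i parS Gp U)) (hΔ2 : IsSymmTr (fun _ => (1 : ℝ)) (Δ2 U)) :
    IsSymmTr (fun _ => (1 : ℝ)) (deltaOneQY i 𝔮 𝔮s parS Gp Δ2 U) := by
  rw [deltaOneQY]
  exact isSymmTr_sub (deltaPiAQY_isSymmTr i 𝔮 𝔮s parS Gp U hG hU hQ hGp hR)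
    (delta2PiY_isSymmTr i parS Gp Δ2 U (fun μ x => hG (hU μ x)) hGp hR hΔ2)

/-- ★★ **`G₁[𝔮](U) = Ring.inverse G₁⁻¹[𝔮](U)` (3.128)–(3.129) IS SYMMETRIC** at `G`-valued data when `Δ⁽²⁾(U)` is (invertible or not).
[cite: Balaban1985BackgroundPropagators, (3.128)–(3.129) p.421, (3.138) p.423] -/
theorem G1QY_isSymmTr (hG : G ≤ B7Prop2Explicit.unitaryUnits (Matrix (Fin N) (Fin N) ℂ)) (hU : ∀ μ x, U μ x ∈ G)
    (hQ : IsAdjTr (fun _ => (1 : ℝ)) (fun _ => (1 : ℝ)) (𝔮 U) (𝔮s U)) (hGp : IsSymmTr (fun _ => (1 : ℝ)) (Gp U))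
    (hR : IsSymmTr (fun _ => (1 : ℝ)) (RY i parS Gp U)) (hΔ2 : IsSymmTr (fun _ => (1 : ℝ)) (Δ2 U)) :
    IsSymmTr (fun _ => (1 : ℝ)) (G1QY i 𝔮 𝔮s parS Gp Δ2 U) :=
  isSymmTr_ringInverse _ (deltaOneQY_isSymmTr i 𝔮 𝔮s parS Gp Δ2 U hG hU hQ hGp hR hΔ2)

/-- `(𝔮 𝒢 𝔮⋆)(U)` IS SYMMETRIC for a symmetric bond-sector letter `𝒢` and an adjoint pair. [cite: Balaban1985BackgroundPropagators, (3.123) p.420, (3.132) p.422, p.393] -/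
theorem QGQOfQY_isSymmTr (𝒢 : BondOpY (Matrix (Fin N) (Fin N) ℂ) i) (hQ : IsAdjTr (fun _ => (1 : ℝ)) (fun _ => (1 : ℝ)) (𝔮 U) (𝔮s U))
    (h𝒢 : IsSymmTr (fun _ => (1 : ℝ)) (𝒢 U)) : IsSymmTr (fun _ => (1 : ℝ)) (QGQOfQY i 𝔮 𝔮s 𝒢 U) :=
  isSymmTr_sandwich_of_isAdjTr (isAdjTr_reverse hQ) h𝒢

/-- `(𝔮 𝒢 𝔮⋆)⁻¹(U)` IS SYMMETRIC for a symmetric letter `𝒢` and an adjoint pair (invertible or not). [cite: Balaban1985BackgroundPropagators, (3.123) p.420, (3.132) p.422] -/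
theorem QGQinvOfQY_isSymmTr (𝒢 : BondOpY (Matrix (Fin N) (Fin N) ℂ) i) (hQ : IsAdjTr (fun _ => (1 : ℝ)) (fun _ => (1 : ℝ)) (𝔮 U) (𝔮s U))
    (h𝒢 : IsSymmTr (fun _ => (1 : ℝ)) (𝒢 U)) : IsSymmTr (fun _ => (1 : ℝ)) (QGQinvOfQY i 𝔮 𝔮s 𝒢 U) :=
  isSymmTr_ringInverse _ (QGQOfQY_isSymmTr i 𝔮 𝔮s U 𝒢 hQ h𝒢)

/-- `(𝔮 G̃ 𝔮⋆)(U)` (3.123) IS SYMMETRIC at `G`-valued data for an adjoint pair. [cite: Balaban1985BackgroundPropagators, (3.123) p.420] -/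
theorem QGQQY_isSymmTr (hG : G ≤ B7Prop2Explicit.unitaryUnits (Matrix (Fin N) (Fin N) ℂ)) (hU : ∀ μ x, U μ x ∈ G)
    (hQ : IsAdjTr (fun _ => (1 : ℝ)) (fun _ => (1 : ℝ)) (𝔮 U) (𝔮s U)) (hGp : IsSymmTr (fun _ => (1 : ℝ)) (Gp U))
    (hR : IsSymmTr (fun _ => (1 : ℝ)) (RY i parS Gp U)) : IsSymmTr (fun _ => (1 : ℝ)) (QGQQY i 𝔮 𝔮s parS Gp U) :=
  QGQOfQY_isSymmTr i 𝔮 𝔮s U (GDQY i 𝔮 𝔮s parS Gp) hQ (GDQY_isSymmTr i 𝔮 𝔮s parS Gp U hG hU hQ hGp hR)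

/-- `(𝔮 G̃ 𝔮⋆)⁻¹(U)` (3.123)∕(3.132) IS SYMMETRIC at `G`-valued data for an adjoint pair. [cite: Balaban1985BackgroundPropagators, (3.123) p.420, (3.132) p.422] -/
theorem QGQinvQY_isSymmTr (hG : G ≤ B7Prop2Explicit.unitaryUnits (Matrix (Fin N) (Fin N) ℂ)) (hU : ∀ μ x, U μ x ∈ G)
    (hQ : IsAdjTr (fun _ => (1 : ℝ)) (fun _ => (1 : ℝ)) (𝔮 U) (𝔮s U)) (hGp : IsSymmTr (fun _ => (1 : ℝ)) (Gp U))
    (hR : IsSymmTr (fun _ => (1 : ℝ)) (RY i parS Gp U)) : IsSymmTr (fun _ => (1 : ℝ)) (QGQinvQY i 𝔮 𝔮s parS Gp U) :=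
  isSymmTr_ringInverse _ (QGQQY_isSymmTr i 𝔮 𝔮s parS Gp U hG hU hQ hGp hR)

/-- `(𝔮G₁𝔮⋆)⁻¹(U)` (3.132) IS SYMMETRIC at `G`-valued data for an adjoint pair when `Δ⁽²⁾(U)` is. [cite: Balaban1985BackgroundPropagators, (3.132) p.422] -/
theorem QG1QinvQY_isSymmTr (hG : G ≤ B7Prop2Explicit.unitaryUnits (Matrix (Fin N) (Fin N) ℂ)) (hU : ∀ μ x, U μ x ∈ G)
    (hQ : IsAdjTr (fun _ => (1 : ℝ)) (fun _ => (1 : ℝ)) (𝔮 U) (𝔮s U)) (hGp : IsSymmTr (fun _ => (1 : ℝ)) (Gp U))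
    (hR : IsSymmTr (fun _ => (1 : ℝ)) (RY i parS Gp U)) (hΔ2 : IsSymmTr (fun _ => (1 : ℝ)) (Δ2 U)) :
    IsSymmTr (fun _ => (1 : ℝ)) (QG1QinvQY i 𝔮 𝔮s parS Gp Δ2 U) :=
  QGQinvOfQY_isSymmTr i 𝔮 𝔮s U (G1QY i 𝔮 𝔮s parS Gp Δ2) hQ (G1QY_isSymmTr i 𝔮 𝔮s parS Gp Δ2 U hG hU hQ hGp hR hΔ2)

/-- ★★ **`𝔊[𝔮](U) = 𝔓G₁ = G₁ − G₁𝔮⋆(𝔮G₁𝔮⋆)⁻¹𝔮G₁ − G₁DRD*G₁` (3.153) IS SYMMETRIC** at `G`-valued data for an adjoint pair when `Δ⁽²⁾(U)` is.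
[cite: Balaban1985BackgroundPropagators, (3.153) p.426, (3.147) p.425] -/
theorem GGQY_isSymmTr (hG : G ≤ B7Prop2Explicit.unitaryUnits (Matrix (Fin N) (Fin N) ℂ)) (hU : ∀ μ x, U μ x ∈ G)
    (hQ : IsAdjTr (fun _ => (1 : ℝ)) (fun _ => (1 : ℝ)) (𝔮 U) (𝔮s U)) (hGp : IsSymmTr (fun _ => (1 : ℝ)) (Gp U))
    (hR : IsSymmTr (fun _ => (1 : ℝ)) (RY i parS Gp U)) (hΔ2 : IsSymmTr (fun _ => (1 : ℝ)) (Δ2 U)) :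
    IsSymmTr (fun _ => (1 : ℝ)) (GGQY i 𝔮 𝔮s parS Gp Δ2 U) := by
  have hU' : ∀ μ x, ((U μ x : (Matrix (Fin N) (Fin N) ℂ)ˣ) : Matrix (Fin N) (Fin N) ℂ) ∈ unitary (Matrix (Fin N) (Fin N) ℂ) :=
    fun μ x => hG (hU μ x)
  have h1 : IsSymmTr (fun _ => (1 : ℝ)) (G1QY i 𝔮 𝔮s parS Gp Δ2 U) := G1QY_isSymmTr i 𝔮 𝔮s parS Gp Δ2 U hG hU hQ hGp hR hΔ2
  have hB : IsSymmTr (fun _ => (1 : ℝ)) (QG1QinvQY i 𝔮 𝔮s parS Gp Δ2 U) := QG1QinvQY_isSymmTr i 𝔮 𝔮s parS Gp Δ2 U hG hU hQ hGp hR hΔ2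
  have hS : IsSymmTr (fun _ => (1 : ℝ)) (𝔮s U ∘ₗ QG1QinvQY i 𝔮 𝔮s parS Gp Δ2 U ∘ₗ 𝔮 U) := isSymmTr_sandwich_of_isAdjTr hQ hB
  have hT₁ : IsSymmTr (fun _ => (1 : ℝ))
      (G1QY i 𝔮 𝔮s parS Gp Δ2 U ∘ₗ (𝔮s U ∘ₗ QG1QinvQY i 𝔮 𝔮s parS Gp Δ2 U ∘ₗ 𝔮 U) ∘ₗ G1QY i 𝔮 𝔮s parS Gp Δ2 U) :=
    isSymmTr_sandwich_of_isAdjTr (Q := G1QY i 𝔮 𝔮s parS Gp Δ2 U) (Qs := G1QY i 𝔮 𝔮s parS Gp Δ2 U) (isAdjTr_of_isSymmTr h1) hS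
  have hT₂ : IsSymmTr (fun _ => (1 : ℝ))
      (G1QY i 𝔮 𝔮s parS Gp Δ2 U ∘ₗ (gradY i U ∘ₗ RY i parS Gp U ∘ₗ divY i U) ∘ₗ G1QY i 𝔮 𝔮s parS Gp Δ2 U) :=
    isSymmTr_sandwich_of_isAdjTr (Q := G1QY i 𝔮 𝔮s parS Gp Δ2 U) (Qs := G1QY i 𝔮 𝔮s parS Gp Δ2 U) (isAdjTr_of_isSymmTr h1)
      (gradY_RY_divY_isSymmTr i parS Gp U hU' hR)
  rw [GGQY_eq_3153]
  refine isSymmTr_sub (isSymmTr_sub h1 ?_) ?_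
  · simpa only [LinearMap.comp_assoc] using hT₁
  · simpa only [LinearMap.comp_assoc] using hT₂

/-- ★ **`(𝔮 𝒢 𝔮⋆)(U)` IS POSITIVE DEFINITE** for a positive definite letter `𝒢(U)`, an adjoint pair and `𝔮⋆(U)` injective.
[cite: Balaban1985BackgroundPropagators, (3.132) p.422, (3.25) p.394, p.393 (scalar products)] -/
theorem posDefTr_QGQOfQY (𝒢 : BondOpY (Matrix (Fin N) (Fin N) ℂ) i) (hQ : IsAdjTr (fun _ => (1 : ℝ)) (fun _ => (1 : ℝ)) (𝔮 U) (𝔮s U))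
    (hinj : Function.Injective (𝔮s U)) (hpos : PosDefTr (fun _ => (1 : ℝ)) (𝒢 U)) : PosDefTr (fun _ => (1 : ℝ)) (QGQOfQY i 𝔮 𝔮s 𝒢 U) :=
  posDefTr_sandwich_of_isAdjTr hQ hinj hpos

/-- ★ `(𝔮 𝒢 𝔮⋆)(U)` IS A UNIT for a positive definite `𝒢(U)`, an adjoint pair and `𝔮⋆(U)` injective. [cite: Balaban1985BackgroundPropagators, (3.132) p.422, (3.25) p.394] -/
theorem isUnit_QGQOfQY_of_posDefTr (𝒢 : BondOpY (Matrix (Fin N) (Fin N) ℂ) i) (hQ : IsAdjTr (fun _ => (1 : ℝ)) (fun _ => (1 : ℝ)) (𝔮 U) (𝔮s U))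
    (hinj : Function.Injective (𝔮s U)) (hpos : PosDefTr (fun _ => (1 : ℝ)) (𝒢 U)) : IsUnit (QGQOfQY i 𝔮 𝔮s 𝒢 U) :=
  isUnit_of_posDefTr (posDefTr_QGQOfQY i 𝔮 𝔮s U 𝒢 hQ hinj hpos)

/-- ★★★ **THE UNIT `(𝔮 G₁ 𝔮⋆)(U)` (3.132) FROM `Δ⁽¹⁾(U) > 0` ALONE** (`G₁ = (Δ⁽¹⁾)⁻¹ > 0`), an adjoint pair and `𝔮⋆(U)` injective — the certificate's `hUQ` over a
generic pair. [cite: Balaban1985BackgroundPropagators, (3.132) p.422, (3.128) p.421, (3.138) p.423] -/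
theorem isUnit_QGQOfQY_G1QY_of_posDefTr_deltaOneQY (hQ : IsAdjTr (fun _ => (1 : ℝ)) (fun _ => (1 : ℝ)) (𝔮 U) (𝔮s U))
    (hinj : Function.Injective (𝔮s U)) (hΔ1 : PosDefTr (fun _ => (1 : ℝ)) (deltaOneQY i 𝔮 𝔮s parS Gp Δ2 U)) :
    IsUnit (QGQOfQY i 𝔮 𝔮s (G1QY i 𝔮 𝔮s parS Gp Δ2) U) :=
  isUnit_QGQOfQY_of_posDefTr i 𝔮 𝔮s U (G1QY i 𝔮 𝔮s parS Gp Δ2) hQ hinj (posDefTr_ringInverse hΔ1)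

/-- ★★ the same with `𝔮⋆(U)` injective DISCHARGED from «`𝔮(U)` onto» ((L2) of `Node00.OpsYQLetter`) via the adjointness.
[cite: Balaban1985BackgroundPropagators, (3.132) p.422, (3.128) p.421] [cite: Balaban1985Averaging, (15) p.19] -/
theorem isUnit_QGQOfQY_G1QY_of_posDefTr_deltaOneQY_of_surjective (hQ : IsAdjTr (fun _ => (1 : ℝ)) (fun _ => (1 : ℝ)) (𝔮 U) (𝔮s U))
    (hsurj : Function.Surjective (𝔮 U)) (hΔ1 : PosDefTr (fun _ => (1 : ℝ)) (deltaOneQY i 𝔮 𝔮s parS Gp Δ2 U)) :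
    IsUnit (QGQOfQY i 𝔮 𝔮s (G1QY i 𝔮 𝔮s parS Gp Δ2) U) :=
  isUnit_QGQOfQY_G1QY_of_posDefTr_deltaOneQY i 𝔮 𝔮s parS Gp Δ2 U hQ (injective_of_isAdjTr_of_surjective (fun _ => one_pos) hQ hsurj) hΔ1

/-! ### At def-Y's symmetrised tables `parSymY ∕ GpPhysY (parSymY)`: the table inputs discharged -/

/-- ★★ `G̃[𝔮](U)` FED `G′_phys` OVER THE SYMMETRISED TRANSPORTERS IS SYMMETRIC at a `G`-valued configuration, `G ≤ U(N)`, for an adjoint pair.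
[cite: Balaban1985BackgroundPropagators, (3.122)–(3.123) p.420, (3.24)–(3.25) p.394, (3.35) p.396] -/
theorem GDQY_GpPhysY_isSymmTr_parSymY (hG : G ≤ B7Prop2Explicit.unitaryUnits (Matrix (Fin N) (Fin N) ℂ)) {U : CfgY (Matrix (Fin N) (Fin N) ℂ) i}
    (hU : ∀ μ x, U μ x ∈ G) (hQ : IsAdjTr (fun _ => (1 : ℝ)) (fun _ => (1 : ℝ)) (𝔮 U) (𝔮s U)) :
    IsSymmTr (fun _ => (1 : ℝ)) (GDQY i 𝔮 𝔮s (parSymY i) (GpPhysY i (parSymY i)) U) :=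
  GDQY_isSymmTr i 𝔮 𝔮s (parSymY i) (GpPhysY i (parSymY i)) U hG hU hQ (isSymmTr_GpPhysY_parSymY i hG hU) (RY_GpPhysY_parSymY_isSymmTr i hG hU)

/-- ★★ `G₁[𝔮](U)` fed `G′_phys` over the symmetrised transporters IS SYMMETRIC at a `G`-valued configuration, for an adjoint pair and symmetric `Δ⁽²⁾(U)`.
[cite: Balaban1985BackgroundPropagators, (3.128)–(3.129) p.421, (3.35) p.396] -/
theorem G1QY_GpPhysY_isSymmTr_parSymY (hG : G ≤ B7Prop2Explicit.unitaryUnits (Matrix (Fin N) (Fin N) ℂ)) {U : CfgY (Matrix (Fin N) (Fin N) ℂ) i}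
    (hU : ∀ μ x, U μ x ∈ G) (hQ : IsAdjTr (fun _ => (1 : ℝ)) (fun _ => (1 : ℝ)) (𝔮 U) (𝔮s U)) (Δ2 : BondOpY (Matrix (Fin N) (Fin N) ℂ) i)
    (hΔ2 : IsSymmTr (fun _ => (1 : ℝ)) (Δ2 U)) : IsSymmTr (fun _ => (1 : ℝ)) (G1QY i 𝔮 𝔮s (parSymY i) (GpPhysY i (parSymY i)) Δ2 U) :=
  G1QY_isSymmTr i 𝔮 𝔮s (parSymY i) (GpPhysY i (parSymY i)) Δ2 U hG hU hQ (isSymmTr_GpPhysY_parSymY i hG hU)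
    (RY_GpPhysY_parSymY_isSymmTr i hG hU) hΔ2

/-- `(𝔮G₁𝔮⋆)⁻¹(U)` fed `G′_phys` over the symmetrised transporters IS SYMMETRIC at a `G`-valued configuration, for an adjoint pair and symmetric `Δ⁽²⁾(U)`.
[cite: Balaban1985BackgroundPropagators, (3.132) p.422, (3.35) p.396] -/
theorem QG1QinvQY_GpPhysY_isSymmTr_parSymY (hG : G ≤ B7Prop2Explicit.unitaryUnits (Matrix (Fin N) (Fin N) ℂ)) {U : CfgY (Matrix (Fin N) (Fin N) ℂ) i}
    (hU : ∀ μ x, U μ x ∈ G) (hQ : IsAdjTr (fun _ => (1 : ℝ)) (fun _ => (1 : ℝ)) (𝔮 U) (𝔮s U)) (Δ2 : BondOpY (Matrix (Fin N) (Fin N) ℂ) i)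
    (hΔ2 : IsSymmTr (fun _ => (1 : ℝ)) (Δ2 U)) : IsSymmTr (fun _ => (1 : ℝ)) (QG1QinvQY i 𝔮 𝔮s (parSymY i) (GpPhysY i (parSymY i)) Δ2 U) :=
  QG1QinvQY_isSymmTr i 𝔮 𝔮s (parSymY i) (GpPhysY i (parSymY i)) Δ2 U hG hU hQ (isSymmTr_GpPhysY_parSymY i hG hU)
    (RY_GpPhysY_parSymY_isSymmTr i hG hU) hΔ2

/-- ★★ `𝔊[𝔮](U)` (3.153) fed `G′_phys` over the symmetrised transporters IS SYMMETRIC at a `G`-valued configuration, for an adjoint pair and symmetric `Δ⁽²⁾(U)`.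
[cite: Balaban1985BackgroundPropagators, (3.153) p.426, (3.35) p.396] -/
theorem GGQY_GpPhysY_isSymmTr_parSymY (hG : G ≤ B7Prop2Explicit.unitaryUnits (Matrix (Fin N) (Fin N) ℂ)) {U : CfgY (Matrix (Fin N) (Fin N) ℂ) i}
    (hU : ∀ μ x, U μ x ∈ G) (hQ : IsAdjTr (fun _ => (1 : ℝ)) (fun _ => (1 : ℝ)) (𝔮 U) (𝔮s U)) (Δ2 : BondOpY (Matrix (Fin N) (Fin N) ℂ) i)
    (hΔ2 : IsSymmTr (fun _ => (1 : ℝ)) (Δ2 U)) : IsSymmTr (fun _ => (1 : ℝ)) (GGQY i 𝔮 𝔮s (parSymY i) (GpPhysY i (parSymY i)) Δ2 U) :=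
  GGQY_isSymmTr i 𝔮 𝔮s (parSymY i) (GpPhysY i (parSymY i)) Δ2 U hG hU hQ (isSymmTr_GpPhysY_parSymY i hG hU)
    (RY_GpPhysY_parSymY_isSymmTr i hG hU) hΔ2

/-- ★★★ **THE UNIT `(𝔮G₁𝔮⋆)(U)` FROM `Δ⁽¹⁾(U) > 0`, WITH `G′_phys` IN THE COMPOSITES** over the symmetrised transporters (the certificate's `hUQ` shape at the
v10 record), for an adjoint pair with `𝔮⋆(U)` injective. [cite: Balaban1985BackgroundPropagators, (3.132) p.422, (3.128) p.421, (3.138) p.423, (3.35) p.396] -/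
theorem isUnit_QGQOfQY_G1QY_recordP_of_posDefTr {U : CfgY (Matrix (Fin N) (Fin N) ℂ) i}
    (hQ : IsAdjTr (fun _ => (1 : ℝ)) (fun _ => (1 : ℝ)) (𝔮 U) (𝔮s U)) (hinj : Function.Injective (𝔮s U)) (Δ2 : BondOpY (Matrix (Fin N) (Fin N) ℂ) i)
    (hΔ1 : PosDefTr (fun _ => (1 : ℝ)) (deltaOneQY i 𝔮 𝔮s (parSymY i) (GpPhysY i (parSymY i)) Δ2 U)) :
    IsUnit (QGQOfQY i 𝔮 𝔮s (G1QY i 𝔮 𝔮s (parSymY i) (GpPhysY i (parSymY i)) Δ2) U) :=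
  isUnit_QGQOfQY_G1QY_of_posDefTr_deltaOneQY i 𝔮 𝔮s (parSymY i) (GpPhysY i (parSymY i)) Δ2 U hQ hinj hΔ1

end SymmQ

/-! ### `G[𝔮]` fed `G′_phys` is `G[𝔮]` fed `G′_latt` (one site propagator behind Sect. B and Sect. D) -/

section GpPhys

variable {𝔸 : Type} [NormedRing 𝔸] [NormedAlgebra ℂ 𝔸] [CompleteSpace 𝔸]
variable (i : KIdx d ℓ hd hL b₀ b₁) (𝔮 : QLetterY 𝔸 i) (𝔮s : QsLetterY 𝔸 i) (parS : SiteParY 𝔸 i)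

/-- `Δ_a[𝔮]` reads `G′` only through `R[G′]`, and `R[G′_phys] = R[G′_latt]` (generic `𝔸`; dag-n06-j's `B9Thm311PosDefAveragingSwap.deltaAQY_GpPhysY` is the
`𝔸 = M_N(ℂ)` instance, by name). [cite: Balaban1985BackgroundPropagators, (3.26) p.395, (3.20) p.394, (3.25) p.394] -/
theorem deltaAQY_GpPhysY_eq (U : CfgY 𝔸 i) : deltaAQY i 𝔮 𝔮s parS (GpPhysY i parS) U = deltaAQY i 𝔮 𝔮s parS (GpY i parS) U := by
  rw [deltaAQY, deltaAQY, RY_GpPhysY]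

/-- ★ `G[𝔮]` (3.27) fed `G′_phys` IS `G[𝔮]` fed `G′_latt`. [cite: Balaban1985BackgroundPropagators, (3.27) p.395, (3.25) p.394] -/
theorem GAQY_GpPhysY : GAQY i 𝔮 𝔮s parS (GpPhysY i parS) = GAQY i 𝔮 𝔮s parS (GpY i parS) :=
  funext fun U => congrArg Ring.inverse (deltaAQY_GpPhysY_eq i 𝔮 𝔮s parS U)

end GpPhys

/-! ## §2 ★★ THE v10 LETTERS OF RECORD BY NAME: base rows, the Sect. B∕D∕E composites, `hsymD`, the unit `(𝔮G₁𝔮⋆)` -/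

section Record

open scoped Matrix.Norms.L2Operator

/-- ★★★ **THE v10 STAR INSTANCE OF RECORD** over an averaging pair family `(𝔮, 𝔮⋆)` flat at `U = 1`: the star Sect.-E constructor `opsYSectESt` over
dag-n06-i's site-(3.49) layer, BOTH at the v10 letters of record `lettersYOfRecordV10 … 𝔮 𝔮⋆ h𝔮 h𝔮⋆ 𝔯` (the nine `Q`-dependent letters rebuilt over the pair,
composites fed `G′_phys`) — the shape of `opsYStOfRecordV4PE` (which it IS at the straight-contour pair, `opsYStOfRecordV10E_QY`).
[cite: Balaban1985BackgroundPropagators, Thms 3.1–3.15 pp.397–432, (3.115) p.418, (3.122)–(3.132) pp.420–422, (3.156)–(3.158) p.428; Balaban1984PropagatorsII, (2.3) p.224] -/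
def opsYStOfRecordV10E (N : ℕ) (θ : Stage3Params) (Mstar : ℕ) (𝔮 : QFamY N θ) (𝔮s : QsFamY N θ)
    (h𝔮 : ∀ i, 𝔮 i (fun _ _ => 1) = liftMatY (Matrix (Fin N) (Fin N) ℂ) (qK i))
    (h𝔮s : ∀ i, 𝔮s i (fun _ _ => 1) = liftMatY (Matrix (Fin N) (Fin N) ℂ) (qsK i)) (𝔯 : ResY N θ Mstar) (𝔢 : SectEStY N θ Mstar)
    (𝔴 : RWEY N θ Mstar) (𝔈 : ExpsY N θ Mstar) : OpsY N θ Mstar :=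
  opsYSectESt N θ Mstar (opsYS349OfLetters N θ Mstar (lettersYOfRecordV10 N θ Mstar 𝔮 𝔮s h𝔮 h𝔮s 𝔯) 𝔈)
    (lettersYOfRecordV10 N θ Mstar 𝔮 𝔮s h𝔮 h𝔮s 𝔯) 𝔢 𝔴

/-- ★★★ **THE v10 STAR INSTANCE OF RECORD WITH ROW 26 `ν`-READ** over an averaging pair family: `opsYSectESt … (opsYS349NuOfLetters … 𝔏 𝔈) 𝔏 𝔢 𝔴` at
`𝔏 := lettersYOfRecordV10 … 𝔮 𝔮⋆ h𝔮 h𝔮⋆ 𝔯` — the shape the N06 certificate of record reads (`opsYNuStOfRecordV4PE`, which it IS at the straight-contour pair).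
[cite: Balaban1985BackgroundPropagators, Thms 3.1–3.15 pp.397–432, (3.115) p.418, (3.132) p.422, (3.156)–(3.158) p.428; Balaban1984PropagatorsII, (2.3) p.224] -/
def opsYNuStOfRecordV10E (N : ℕ) (θ : Stage3Params) (Mstar : ℕ) (𝔮 : QFamY N θ) (𝔮s : QsFamY N θ)
    (h𝔮 : ∀ i, 𝔮 i (fun _ _ => 1) = liftMatY (Matrix (Fin N) (Fin N) ℂ) (qK i))
    (h𝔮s : ∀ i, 𝔮s i (fun _ _ => 1) = liftMatY (Matrix (Fin N) (Fin N) ℂ) (qsK i)) (𝔯 : ResY N θ Mstar) (𝔢 : SectEStY N θ Mstar)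
    (𝔴 : RWEY N θ Mstar) (𝔈 : ExpsY N θ Mstar) : OpsY N θ Mstar :=
  opsYSectESt N θ Mstar (opsYS349NuOfLetters N θ Mstar (lettersYOfRecordV10 N θ Mstar 𝔮 𝔮s h𝔮 h𝔮s 𝔯) 𝔈)
    (lettersYOfRecordV10 N θ Mstar 𝔮 𝔮s h𝔮 h𝔮s 𝔯) 𝔢 𝔴

variable (N : ℕ) (θ : Stage3Params) (Mstar : ℕ) (𝔮 : QFamY N θ) (𝔮s : QsFamY N θ)
  (h𝔮 : ∀ i, 𝔮 i (fun _ _ => 1) = liftMatY (Matrix (Fin N) (Fin N) ℂ) (qK i))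
  (h𝔮s : ∀ i, 𝔮s i (fun _ _ => 1) = liftMatY (Matrix (Fin N) (Fin N) ℂ) (qsK i)) (𝔯 : ResY N θ Mstar)

/-- the pair-independent letters of the v10 record are the v4P record's (rows 4–12, 22–25 read `parS ∕ parB ∕ G′ ∕ C ∕ P349 ∕ Ck` verbatim, `rfl`).
[cite: Balaban1985BackgroundPropagators, (3.19) p.393, (3.24)–(3.25) p.394, (3.48) p.398, Thm 3.14 pp.426–427, bookkeeping] -/
theorem lettersYOfRecordV10_base (x : MemberY θ.d₆ θ.ℓ₆ θ.hd' θ.hL' θ.b₀ θ.b₁ Mstar) :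
    (lettersYOfRecordV10 N θ Mstar 𝔮 𝔮s h𝔮 h𝔮s 𝔯 x).parS = parSymY x.toKIdx ∧
      (lettersYOfRecordV10 N θ Mstar 𝔮 𝔮s h𝔮 h𝔮s 𝔯 x).parB = parBY x.toKIdx ∧
      (lettersYOfRecordV10 N θ Mstar 𝔮 𝔮s h𝔮 h𝔮s 𝔯 x).Gp = GpY x.toKIdx (parSymY x.toKIdx) ∧
      (lettersYOfRecordV10 N θ Mstar 𝔮 𝔮s h𝔮 h𝔮s 𝔯 x).C = (lettersYOfRecordV4P N θ Mstar 𝔯 x).C ∧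
      (lettersYOfRecordV10 N θ Mstar 𝔮 𝔮s h𝔮 h𝔮s 𝔯 x).P349 = (lettersYOfRecordV4P N θ Mstar 𝔯 x).P349 ∧
      (lettersYOfRecordV10 N θ Mstar 𝔮 𝔮s h𝔮 h𝔮s 𝔯 x).Ck = (lettersYOfRecordV4P N θ Mstar 𝔯 x).Ck := ⟨rfl, rfl, rfl, rfl, rfl, rfl⟩

/-- ★ the Sect. B∕D∕E letters of the v10 record, by name: THE `Q`-DEPENDENT COMPOSITES OVER THE PAIR `(𝔮 x, 𝔮⋆ x)` FED `G′_phys` (the certificate's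
`hGco12 ∕ hG1co12 ∕ hGGco12 ∕ hHm12 ∕ hH1m12 ∕ hQ ∕ hQ₁` pins at the v10 record name these right-hand sides), and `GA = G[𝔮 x]` at lattice units.
[cite: Balaban1985BackgroundPropagators, (3.27) p.395, (3.122)–(3.132) pp.420–422, (3.153) p.426, Thm 3.14 pp.426–427, bookkeeping] -/
theorem lettersYOfRecordV10_sectDE (x : MemberY θ.d₆ θ.ℓ₆ θ.hd' θ.hL' θ.b₀ θ.b₁ Mstar) :
    (lettersYOfRecordV10 N θ Mstar 𝔮 𝔮s h𝔮 h𝔮s 𝔯 x).GD =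
        GDQY x.toKIdx (𝔮 x.toKIdx) (𝔮s x.toKIdx) (parSymY x.toKIdx) (GpPhysY x.toKIdx (parSymY x.toKIdx)) ∧
      (lettersYOfRecordV10 N θ Mstar 𝔮 𝔮s h𝔮 h𝔮s 𝔯 x).QGQinv =
        QGQinvQY x.toKIdx (𝔮 x.toKIdx) (𝔮s x.toKIdx) (parSymY x.toKIdx) (GpPhysY x.toKIdx (parSymY x.toKIdx)) ∧
      (lettersYOfRecordV10 N θ Mstar 𝔮 𝔮s h𝔮 h𝔮s 𝔯 x).H =
        HDQY x.toKIdx (𝔮 x.toKIdx) (𝔮s x.toKIdx) (parSymY x.toKIdx) (GpPhysY x.toKIdx (parSymY x.toKIdx)) ∧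
      (lettersYOfRecordV10 N θ Mstar 𝔮 𝔮s h𝔮 h𝔮s 𝔯 x).G₁ =
        G1QY x.toKIdx (𝔮 x.toKIdx) (𝔮s x.toKIdx) (parSymY x.toKIdx) (GpPhysY x.toKIdx (parSymY x.toKIdx)) (𝔯 x).Δ2 ∧
      (lettersYOfRecordV10 N θ Mstar 𝔮 𝔮s h𝔮 h𝔮s 𝔯 x).QG1Qinv =
        QG1QinvQY x.toKIdx (𝔮 x.toKIdx) (𝔮s x.toKIdx) (parSymY x.toKIdx) (GpPhysY x.toKIdx (parSymY x.toKIdx)) (𝔯 x).Δ2 ∧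
      (lettersYOfRecordV10 N θ Mstar 𝔮 𝔮s h𝔮 h𝔮s 𝔯 x).H₁ =
        H1QY x.toKIdx (𝔮 x.toKIdx) (𝔮s x.toKIdx) (parSymY x.toKIdx) (GpPhysY x.toKIdx (parSymY x.toKIdx)) (𝔯 x).Δ2 ∧
      (lettersYOfRecordV10 N θ Mstar 𝔮 𝔮s h𝔮 h𝔮s 𝔯 x).GG =
        GGQY x.toKIdx (𝔮 x.toKIdx) (𝔮s x.toKIdx) (parSymY x.toKIdx) (GpPhysY x.toKIdx (parSymY x.toKIdx)) (𝔯 x).Δ2 ∧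
      (lettersYOfRecordV10 N θ Mstar 𝔮 𝔮s h𝔮 h𝔮s 𝔯 x).GA =
        GAQY x.toKIdx (𝔮 x.toKIdx) (𝔮s x.toKIdx) (parSymY x.toKIdx) (GpY x.toKIdx (parSymY x.toKIdx)) :=
  ⟨rfl, rfl, rfl, rfl, rfl, rfl, rfl, rfl⟩

/-- ★ the v10 record's `GA = G[𝔮 x]` is ALSO the composite fed `G′_phys`. [cite: Balaban1985BackgroundPropagators, (3.26)–(3.27) p.395, (3.25) p.394] -/
theorem lettersYOfRecordV10_GA_phys (x : MemberY θ.d₆ θ.ℓ₆ θ.hd' θ.hL' θ.b₀ θ.b₁ Mstar) :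
    (lettersYOfRecordV10 N θ Mstar 𝔮 𝔮s h𝔮 h𝔮s 𝔯 x).GA =
      GAQY x.toKIdx (𝔮 x.toKIdx) (𝔮s x.toKIdx) (parSymY x.toKIdx) (GpPhysY x.toKIdx (parSymY x.toKIdx)) :=
  (GAQY_GpPhysY x.toKIdx (𝔮 x.toKIdx) (𝔮s x.toKIdx) (parSymY x.toKIdx)).symm

variable {G : Subgroup (Matrix (Fin N) (Fin N) ℂ)ˣ}

/-- ★★ **THE v10 RECORD'S `GD` IS SYMMETRIC** at every `G`-valued configuration, `G ≤ U(N)`, at which the pair `(𝔮 x, 𝔮⋆ x)` is adjoint.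
[cite: Balaban1985BackgroundPropagators, (3.122)–(3.123) p.420, (3.35) p.396] -/
theorem lettersYOfRecordV10_GD_isSymmTr (hG : G ≤ B7Prop2Explicit.unitaryUnits (Matrix (Fin N) (Fin N) ℂ))
    (x : MemberY θ.d₆ θ.ℓ₆ θ.hd' θ.hL' θ.b₀ θ.b₁ Mstar) {U : CfgY (Matrix (Fin N) (Fin N) ℂ) x.toKIdx} (hU : ∀ μ z, U μ z ∈ G)
    (hQ : IsAdjTr (fun _ => (1 : ℝ)) (fun _ => (1 : ℝ)) (𝔮 x.toKIdx U) (𝔮s x.toKIdx U)) :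
    IsSymmTr (fun _ => (1 : ℝ)) ((lettersYOfRecordV10 N θ Mstar 𝔮 𝔮s h𝔮 h𝔮s 𝔯 x).GD U) :=
  GDQY_GpPhysY_isSymmTr_parSymY x.toKIdx (𝔮 x.toKIdx) (𝔮s x.toKIdx) hG hU hQ

/-- ★★ **THE v10 RECORD'S `G₁` IS SYMMETRIC** at every `G`-valued configuration at which the pair is adjoint and the residual letter `(𝔯 x).Δ2` symmetric.
[cite: Balaban1985BackgroundPropagators, (3.128)–(3.129) p.421, (3.35) p.396] -/
theorem lettersYOfRecordV10_G₁_isSymmTr (hG : G ≤ B7Prop2Explicit.unitaryUnits (Matrix (Fin N) (Fin N) ℂ))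
    (x : MemberY θ.d₆ θ.ℓ₆ θ.hd' θ.hL' θ.b₀ θ.b₁ Mstar) {U : CfgY (Matrix (Fin N) (Fin N) ℂ) x.toKIdx} (hU : ∀ μ z, U μ z ∈ G)
    (hQ : IsAdjTr (fun _ => (1 : ℝ)) (fun _ => (1 : ℝ)) (𝔮 x.toKIdx U) (𝔮s x.toKIdx U)) (hΔ2 : IsSymmTr (fun _ => (1 : ℝ)) ((𝔯 x).Δ2 U)) :
    IsSymmTr (fun _ => (1 : ℝ)) ((lettersYOfRecordV10 N θ Mstar 𝔮 𝔮s h𝔮 h𝔮s 𝔯 x).G₁ U) :=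
  G1QY_GpPhysY_isSymmTr_parSymY x.toKIdx (𝔮 x.toKIdx) (𝔮s x.toKIdx) hG hU hQ (𝔯 x).Δ2 hΔ2

/-- ★★ **THE v10 RECORD'S `GG = 𝔊` IS SYMMETRIC** at every `G`-valued configuration at which the pair is adjoint and the residual letter `(𝔯 x).Δ2` symmetric.
[cite: Balaban1985BackgroundPropagators, (3.153) p.426, (3.35) p.396] -/
theorem lettersYOfRecordV10_GG_isSymmTr (hG : G ≤ B7Prop2Explicit.unitaryUnits (Matrix (Fin N) (Fin N) ℂ))
    (x : MemberY θ.d₆ θ.ℓ₆ θ.hd' θ.hL' θ.b₀ θ.b₁ Mstar) {U : CfgY (Matrix (Fin N) (Fin N) ℂ) x.toKIdx} (hU : ∀ μ z, U μ z ∈ G)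
    (hQ : IsAdjTr (fun _ => (1 : ℝ)) (fun _ => (1 : ℝ)) (𝔮 x.toKIdx U) (𝔮s x.toKIdx U)) (hΔ2 : IsSymmTr (fun _ => (1 : ℝ)) ((𝔯 x).Δ2 U)) :
    IsSymmTr (fun _ => (1 : ℝ)) ((lettersYOfRecordV10 N θ Mstar 𝔮 𝔮s h𝔮 h𝔮s 𝔯 x).GG U) :=
  GGQY_GpPhysY_isSymmTr_parSymY x.toKIdx (𝔮 x.toKIdx) (𝔮s x.toKIdx) hG hU hQ (𝔯 x).Δ2 hΔ2

/-- ★★★ **THE CERTIFICATE's `hsymD` AT THE v10 RECORD** (`GD ∧ G₁ ∧ GG` symmetric at special-unitary configurations) from two displayed hypotheses: the pair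
`(𝔮 x, 𝔮⋆ x)` ADJOINT at special-unitary configurations ((L3) of `Node00.OpsYQLetter` on that regime) and a symmetric residual letter.
[cite: Balaban1985BackgroundPropagators, (3.122) p.420, (3.128) p.421, (3.153) p.426, (3.35) p.396, p.393 (Q* the adjoint of Q)] -/
theorem lettersYOfRecordV10_symmDG₁GG
    (hQ : ∀ (x : MemberY θ.d₆ θ.ℓ₆ θ.hd' θ.hL' θ.b₀ θ.b₁ Mstar) (U : CfgY (Matrix (Fin N) (Fin N) ℂ) x.toKIdx), (∀ μ z, U μ z ∈ specialUnitaryUnits (Fin N)) →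
      IsAdjTr (fun _ => (1 : ℝ)) (fun _ => (1 : ℝ)) (𝔮 x.toKIdx U) (𝔮s x.toKIdx U))
    (hΔ2 : ∀ (x : MemberY θ.d₆ θ.ℓ₆ θ.hd' θ.hL' θ.b₀ θ.b₁ Mstar) (U : CfgY (Matrix (Fin N) (Fin N) ℂ) x.toKIdx), (∀ μ z, U μ z ∈ specialUnitaryUnits (Fin N)) →
      IsSymmTr (fun _ => (1 : ℝ)) ((𝔯 x).Δ2 U)) :
    ∀ (x : MemberY θ.d₆ θ.ℓ₆ θ.hd' θ.hL' θ.b₀ θ.b₁ Mstar) (U : CfgY (Matrix (Fin N) (Fin N) ℂ) x.toKIdx), (∀ μ z, U μ z ∈ specialUnitaryUnits (Fin N)) →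
      IsSymmTr (fun _ => (1 : ℝ)) ((lettersYOfRecordV10 N θ Mstar 𝔮 𝔮s h𝔮 h𝔮s 𝔯 x).GD U) ∧
        IsSymmTr (fun _ => (1 : ℝ)) ((lettersYOfRecordV10 N θ Mstar 𝔮 𝔮s h𝔮 h𝔮s 𝔯 x).G₁ U) ∧
        IsSymmTr (fun _ => (1 : ℝ)) ((lettersYOfRecordV10 N θ Mstar 𝔮 𝔮s h𝔮 h𝔮s 𝔯 x).GG U) :=
  fun x U hU => ⟨lettersYOfRecordV10_GD_isSymmTr N θ Mstar 𝔮 𝔮s h𝔮 h𝔮s 𝔯 specialUnitaryUnits_le_unitaryUnits x hU (hQ x U hU),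
    lettersYOfRecordV10_G₁_isSymmTr N θ Mstar 𝔮 𝔮s h𝔮 h𝔮s 𝔯 specialUnitaryUnits_le_unitaryUnits x hU (hQ x U hU) (hΔ2 x U hU),
    lettersYOfRecordV10_GG_isSymmTr N θ Mstar 𝔮 𝔮s h𝔮 h𝔮s 𝔯 specialUnitaryUnits_le_unitaryUnits x hU (hQ x U hU) (hΔ2 x U hU)⟩

/-- ★ **THE UNIT `(𝔮G₁𝔮⋆)(U)` AT THE v10 RECORD** from `Δ⁽¹⁾(U) > 0`, the adjointness of the pair at `U` and `𝔮⋆ x (U)` injective (the certificate's `hUQ`).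
[cite: Balaban1985BackgroundPropagators, (3.132) p.422, (3.128) p.421, (3.138) p.423] -/
theorem lettersYOfRecordV10_isUnit_QGQOfQY_G₁ (x : MemberY θ.d₆ θ.ℓ₆ θ.hd' θ.hL' θ.b₀ θ.b₁ Mstar) {U : CfgY (Matrix (Fin N) (Fin N) ℂ) x.toKIdx}
    (hQ : IsAdjTr (fun _ => (1 : ℝ)) (fun _ => (1 : ℝ)) (𝔮 x.toKIdx U) (𝔮s x.toKIdx U)) (hinj : Function.Injective (𝔮s x.toKIdx U))
    (hΔ1 : PosDefTr (fun _ => (1 : ℝ))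
      (deltaOneQY x.toKIdx (𝔮 x.toKIdx) (𝔮s x.toKIdx) (parSymY x.toKIdx) (GpPhysY x.toKIdx (parSymY x.toKIdx)) (𝔯 x).Δ2 U)) :
    IsUnit (QGQOfQY x.toKIdx (𝔮 x.toKIdx) (𝔮s x.toKIdx) (lettersYOfRecordV10 N θ Mstar 𝔮 𝔮s h𝔮 h𝔮s 𝔯 x).G₁ U) :=
  isUnit_QGQOfQY_G1QY_recordP_of_posDefTr x.toKIdx (𝔮 x.toKIdx) (𝔮s x.toKIdx) hQ hinj (𝔯 x).Δ2 hΔ1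

/-- ★ the same with injectivity DISCHARGED from «`𝔮 x (U)` onto» ((L2)). [cite: Balaban1985BackgroundPropagators, (3.132) p.422, (3.128) p.421] [cite: Balaban1985Averaging, (15) p.19] -/
theorem lettersYOfRecordV10_isUnit_QGQOfQY_G₁_of_surjective (x : MemberY θ.d₆ θ.ℓ₆ θ.hd' θ.hL' θ.b₀ θ.b₁ Mstar)
    {U : CfgY (Matrix (Fin N) (Fin N) ℂ) x.toKIdx} (hQ : IsAdjTr (fun _ => (1 : ℝ)) (fun _ => (1 : ℝ)) (𝔮 x.toKIdx U) (𝔮s x.toKIdx U))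
    (hsurj : Function.Surjective (𝔮 x.toKIdx U))
    (hΔ1 : PosDefTr (fun _ => (1 : ℝ))
      (deltaOneQY x.toKIdx (𝔮 x.toKIdx) (𝔮s x.toKIdx) (parSymY x.toKIdx) (GpPhysY x.toKIdx (parSymY x.toKIdx)) (𝔯 x).Δ2 U)) :
    IsUnit (QGQOfQY x.toKIdx (𝔮 x.toKIdx) (𝔮s x.toKIdx) (lettersYOfRecordV10 N θ Mstar 𝔮 𝔮s h𝔮 h𝔮s 𝔯 x).G₁ U) :=
  lettersYOfRecordV10_isUnit_QGQOfQY_G₁ N θ Mstar 𝔮 𝔮s h𝔮 h𝔮s 𝔯 x hQ (injective_of_isAdjTr_of_surjective (fun _ => one_pos) hQ hsurj) hΔ1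

/-! ### At the straight-contour pair of record the v10 record IS the v4P record -/

/-- the straight-contour family of record is flat at `U = 1` (its `h𝔮` argument, by name). [cite: Balaban1985BackgroundPropagators, (3.12) p.392, Cor. 3.5 p.407] -/
theorem qYOfRecord_flat : ∀ i : KIdx θ.d₆ θ.ℓ₆ θ.hd' θ.hL' θ.b₀ θ.b₁, qYOfRecord N θ i (fun _ _ => 1) = liftMatY (Matrix (Fin N) (Fin N) ℂ) (qK i) :=
  fun i => QY_one i (parBY_one i)

/-- its adjoint family of record is flat at `U = 1` (the `h𝔮⋆` argument, by name). [cite: Balaban1985BackgroundPropagators, (3.13) p.392, Cor. 3.5 p.407] -/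
theorem qsYOfRecord_flat : ∀ i : KIdx θ.d₆ θ.ℓ₆ θ.hd' θ.hL' θ.b₀ θ.b₁, qsYOfRecord N θ i (fun _ _ => 1) = liftMatY (Matrix (Fin N) (Fin N) ℂ) (qsK i) :=
  fun i => QsY_one i (parBY_one i)

/-- ★★ **AT THE STRAIGHT-CONTOUR PAIR OF RECORD `(qYOfRecord, qsYOfRecord)` THE v10 LETTERS OF RECORD ARE THE v4P LETTERS OF RECORD** (any flatness
witnesses). [cite: Balaban1985BackgroundPropagators, (3.12)–(3.13) p.392, (3.122)–(3.132) pp.420–422, bookkeeping] -/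
theorem lettersYOfRecordV10_qYOfRecord (h𝔮 : ∀ i, qYOfRecord N θ i (fun _ _ => 1) = liftMatY (Matrix (Fin N) (Fin N) ℂ) (qK i))
    (h𝔮s : ∀ i, qsYOfRecord N θ i (fun _ _ => 1) = liftMatY (Matrix (Fin N) (Fin N) ℂ) (qsK i)) (𝔯 : ResY N θ Mstar) :
    lettersYOfRecordV10 N θ Mstar (qYOfRecord N θ) (qsYOfRecord N θ) h𝔮 h𝔮s 𝔯 = lettersYOfRecordV4P N θ Mstar 𝔯 :=
  lettersYOfRecordV10_QY 𝔯

/-! ## §3 ★★★ THE TWO STAR INSTANCES `opsYStOfRecordV10E ∕ opsYNuStOfRecordV10E` AND THEIR FACES -/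

variable (𝔢 : SectEStY N θ Mstar) (𝔴 : RWEY N θ Mstar) (𝔈 : ExpsY N θ Mstar)

/-- ★★ AT THE STRAIGHT-CONTOUR PAIR the plain v10 star instance IS def-Y's `opsYStOfRecordV4PE` (one rewrite by `lettersYOfRecordV10_QY`).
[cite: Balaban1985BackgroundPropagators, (3.12)–(3.13) p.392, Thm 3.15 p.432, bookkeeping] -/
theorem opsYStOfRecordV10E_QY :
    opsYStOfRecordV10E N θ Mstar (fun i => QY i (parBY i)) (fun i => QsY i (parBY i)) (fun i => QY_one i (parBY_one i))
        (fun i => QsY_one i (parBY_one i)) 𝔯 𝔢 𝔴 𝔈 = opsYStOfRecordV4PE N θ Mstar 𝔯 𝔢 𝔴 𝔈 :=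
  congrArg (fun 𝔏 : LettersY N θ Mstar => opsYSectESt N θ Mstar (opsYS349OfLetters N θ Mstar 𝔏 𝔈) 𝔏 𝔢 𝔴) (lettersYOfRecordV10_QY 𝔯)

/-- ★★ AT THE STRAIGHT-CONTOUR PAIR the `ν`-read v10 star instance IS def-Y's `opsYNuStOfRecordV4PE` — the object the landed N06 certificates elaborate against.
[cite: Balaban1985BackgroundPropagators, (3.12)–(3.13) p.392, (3.132) p.422, Thm 3.15 p.432, bookkeeping] -/
theorem opsYNuStOfRecordV10E_QY :
    opsYNuStOfRecordV10E N θ Mstar (fun i => QY i (parBY i)) (fun i => QsY i (parBY i)) (fun i => QY_one i (parBY_one i))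
        (fun i => QsY_one i (parBY_one i)) 𝔯 𝔢 𝔴 𝔈 = opsYNuStOfRecordV4PE N θ Mstar 𝔯 𝔢 𝔴 𝔈 :=
  congrArg (fun 𝔏 : LettersY N θ Mstar => opsYSectESt N θ Mstar (opsYS349NuOfLetters N θ Mstar 𝔏 𝔈) 𝔏 𝔢 𝔴) (lettersYOfRecordV10_QY 𝔯)

/-- the same keyed by the named families of record `qYOfRecord ∕ qsYOfRecord` (any flatness witnesses). [cite: Balaban1985BackgroundPropagators, (3.12)–(3.13) p.392, bookkeeping] -/
theorem opsYStOfRecordV10E_qYOfRecord (h𝔮 : ∀ i, qYOfRecord N θ i (fun _ _ => 1) = liftMatY (Matrix (Fin N) (Fin N) ℂ) (qK i))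
    (h𝔮s : ∀ i, qsYOfRecord N θ i (fun _ _ => 1) = liftMatY (Matrix (Fin N) (Fin N) ℂ) (qsK i)) :
    opsYStOfRecordV10E N θ Mstar (qYOfRecord N θ) (qsYOfRecord N θ) h𝔮 h𝔮s 𝔯 𝔢 𝔴 𝔈 = opsYStOfRecordV4PE N θ Mstar 𝔯 𝔢 𝔴 𝔈 :=
  congrArg (fun 𝔏 : LettersY N θ Mstar => opsYSectESt N θ Mstar (opsYS349OfLetters N θ Mstar 𝔏 𝔈) 𝔏 𝔢 𝔴)
    (lettersYOfRecordV10_qYOfRecord N θ Mstar h𝔮 h𝔮s 𝔯)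

/-- the same for the `ν`-read instance. [cite: Balaban1985BackgroundPropagators, (3.12)–(3.13) p.392, (3.132) p.422, bookkeeping] -/
theorem opsYNuStOfRecordV10E_qYOfRecord (h𝔮 : ∀ i, qYOfRecord N θ i (fun _ _ => 1) = liftMatY (Matrix (Fin N) (Fin N) ℂ) (qK i))
    (h𝔮s : ∀ i, qsYOfRecord N θ i (fun _ _ => 1) = liftMatY (Matrix (Fin N) (Fin N) ℂ) (qsK i)) :
    opsYNuStOfRecordV10E N θ Mstar (qYOfRecord N θ) (qsYOfRecord N θ) h𝔮 h𝔮s 𝔯 𝔢 𝔴 𝔈 = opsYNuStOfRecordV4PE N θ Mstar 𝔯 𝔢 𝔴 𝔈 :=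
  congrArg (fun 𝔏 : LettersY N θ Mstar => opsYSectESt N θ Mstar (opsYS349NuOfLetters N θ Mstar 𝔏 𝔈) 𝔏 𝔢 𝔴)
    (lettersYOfRecordV10_qYOfRecord N θ Mstar h𝔮 h𝔮s 𝔯)

/-! ### The two instances, unfolded field by field (`rfl` transport for the certificate's rows) -/

/-- the plain v10 star instance at a member, unfolded. [cite: Balaban1985BackgroundPropagators, Thm 3.15 p.432, bookkeeping] -/
theorem opsYStOfRecordV10E_apply (x : MemberY θ.d₆ θ.ℓ₆ θ.hd' θ.hL' θ.b₀ θ.b₁ Mstar) :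
    opsYStOfRecordV10E N θ Mstar 𝔮 𝔮s h𝔮 h𝔮s 𝔯 𝔢 𝔴 𝔈 x =
      operatorLayerYSectESt (Matrix (Fin N) (Fin N) ℂ) (specialUnitaryUnits (Fin N)) x
        (opsYS349OfLetters N θ Mstar (lettersYOfRecordV10 N θ Mstar 𝔮 𝔮s h𝔮 h𝔮s 𝔯) 𝔈 x) (lettersYOfRecordV10 N θ Mstar 𝔮 𝔮s h𝔮 h𝔮s 𝔯 x)
        (𝔢 x) (𝔴 x) := rfl

/-- the `ν`-read v10 star instance at a member, unfolded. [cite: Balaban1985BackgroundPropagators, Thm 3.15 p.432, (3.132) p.422, bookkeeping] -/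
theorem opsYNuStOfRecordV10E_apply (x : MemberY θ.d₆ θ.ℓ₆ θ.hd' θ.hL' θ.b₀ θ.b₁ Mstar) :
    opsYNuStOfRecordV10E N θ Mstar 𝔮 𝔮s h𝔮 h𝔮s 𝔯 𝔢 𝔴 𝔈 x =
      operatorLayerYSectESt (Matrix (Fin N) (Fin N) ℂ) (specialUnitaryUnits (Fin N)) x
        (opsYS349NuOfLetters N θ Mstar (lettersYOfRecordV10 N θ Mstar 𝔮 𝔮s h𝔮 h𝔮s 𝔯) 𝔈 x) (lettersYOfRecordV10 N θ Mstar 𝔮 𝔮s h𝔮 h𝔮s 𝔯 x)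
        (𝔢 x) (𝔴 x) := rfl

/-- ★ ROWS 17, 20–23, 26 and the walk slot of the plain v10 star instance ARE def-Y's BASE READINGS `opsYOfLetters` of the v10 letters of record (`rfl`).
[cite: Balaban1985BackgroundPropagators, Thms 3.1–3.14 pp.397–427, (3.49) p.399, bookkeeping] -/
theorem opsYStOfRecordV10E_letters (x : MemberY θ.d₆ θ.ℓ₆ θ.hd' θ.hL' θ.b₀ θ.b₁ Mstar) :
    (opsYStOfRecordV10E N θ Mstar 𝔮 𝔮s h𝔮 h𝔮s 𝔯 𝔢 𝔴 𝔈 x).Gp = (opsYOfLetters N θ Mstar (lettersYOfRecordV10 N θ Mstar 𝔮 𝔮s h𝔮 h𝔮s 𝔯) 𝔈 x).Gp ∧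
      (opsYStOfRecordV10E N θ Mstar 𝔮 𝔮s h𝔮 h𝔮s 𝔯 𝔢 𝔴 𝔈 x).GA = (opsYOfLetters N θ Mstar (lettersYOfRecordV10 N θ Mstar 𝔮 𝔮s h𝔮 h𝔮s 𝔯) 𝔈 x).GA ∧
      (opsYStOfRecordV10E N θ Mstar 𝔮 𝔮s h𝔮 h𝔮s 𝔯 𝔢 𝔴 𝔈 x).Cinv = (opsYOfLetters N θ Mstar (lettersYOfRecordV10 N θ Mstar 𝔮 𝔮s h𝔮 h𝔮s 𝔯) 𝔈 x).Cinv ∧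
      (opsYStOfRecordV10E N θ Mstar 𝔮 𝔮s h𝔮 h𝔮s 𝔯 𝔢 𝔴 𝔈 x).GD = (opsYOfLetters N θ Mstar (lettersYOfRecordV10 N θ Mstar 𝔮 𝔮s h𝔮 h𝔮s 𝔯) 𝔈 x).GD ∧
      (opsYStOfRecordV10E N θ Mstar 𝔮 𝔮s h𝔮 h𝔮s 𝔯 𝔢 𝔴 𝔈 x).G₁ = (opsYOfLetters N θ Mstar (lettersYOfRecordV10 N θ Mstar 𝔮 𝔮s h𝔮 h𝔮s 𝔯) 𝔈 x).G₁ ∧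
      (opsYStOfRecordV10E N θ Mstar 𝔮 𝔮s h𝔮 h𝔮s 𝔯 𝔢 𝔴 𝔈 x).H = (opsYOfLetters N θ Mstar (lettersYOfRecordV10 N θ Mstar 𝔮 𝔮s h𝔮 h𝔮s 𝔯) 𝔈 x).H ∧
      (opsYStOfRecordV10E N θ Mstar 𝔮 𝔮s h𝔮 h𝔮s 𝔯 𝔢 𝔴 𝔈 x).H₁ = (opsYOfLetters N θ Mstar (lettersYOfRecordV10 N θ Mstar 𝔮 𝔮s h𝔮 h𝔮s 𝔯) 𝔈 x).H₁ ∧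
      (opsYStOfRecordV10E N θ Mstar 𝔮 𝔮s h𝔮 h𝔮s 𝔯 𝔢 𝔴 𝔈 x).GG = (opsYOfLetters N θ Mstar (lettersYOfRecordV10 N θ Mstar 𝔮 𝔮s h𝔮 h𝔮s 𝔯) 𝔈 x).GG ∧
      (opsYStOfRecordV10E N θ Mstar 𝔮 𝔮s h𝔮 h𝔮s 𝔯 𝔢 𝔴 𝔈 x).Kdiff =
        (opsYOfLetters N θ Mstar (lettersYOfRecordV10 N θ Mstar 𝔮 𝔮s h𝔮 h𝔮s 𝔯) 𝔈 x).Kdiff ∧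
      (opsYStOfRecordV10E N θ Mstar 𝔮 𝔮s h𝔮 h𝔮s 𝔯 𝔢 𝔴 𝔈 x).QGQinv =
        (opsYOfLetters N θ Mstar (lettersYOfRecordV10 N θ Mstar 𝔮 𝔮s h𝔮 h𝔮s 𝔯) 𝔈 x).QGQinv ∧
      (opsYStOfRecordV10E N θ Mstar 𝔮 𝔮s h𝔮 h𝔮s 𝔯 𝔢 𝔴 𝔈 x).QG1Qinv =
        (opsYOfLetters N θ Mstar (lettersYOfRecordV10 N θ Mstar 𝔮 𝔮s h𝔮 h𝔮s 𝔯) 𝔈 x).QG1Qinv :=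
  ⟨rfl, rfl, rfl, rfl, rfl, rfl, rfl, rfl, rfl, rfl, rfl⟩

/-- ★ ROWS 17, 20–23 and the walk slot of the `ν`-read v10 star instance ARE def-Y's BASE READINGS `opsYOfLetters` of the v10 letters of record (`rfl`; its two
(3.132) kernels are the `ν`-readings, `opsYNuStOfRecordV10E_QGQinv_QG1Qinv`). [cite: Balaban1985BackgroundPropagators, Thms 3.1–3.14 pp.397–427, (3.49) p.399, bookkeeping] -/
theorem opsYNuStOfRecordV10E_letters (x : MemberY θ.d₆ θ.ℓ₆ θ.hd' θ.hL' θ.b₀ θ.b₁ Mstar) :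
    (opsYNuStOfRecordV10E N θ Mstar 𝔮 𝔮s h𝔮 h𝔮s 𝔯 𝔢 𝔴 𝔈 x).Gp = (opsYOfLetters N θ Mstar (lettersYOfRecordV10 N θ Mstar 𝔮 𝔮s h𝔮 h𝔮s 𝔯) 𝔈 x).Gp ∧
      (opsYNuStOfRecordV10E N θ Mstar 𝔮 𝔮s h𝔮 h𝔮s 𝔯 𝔢 𝔴 𝔈 x).GA = (opsYOfLetters N θ Mstar (lettersYOfRecordV10 N θ Mstar 𝔮 𝔮s h𝔮 h𝔮s 𝔯) 𝔈 x).GA ∧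
      (opsYNuStOfRecordV10E N θ Mstar 𝔮 𝔮s h𝔮 h𝔮s 𝔯 𝔢 𝔴 𝔈 x).Cinv =
        (opsYOfLetters N θ Mstar (lettersYOfRecordV10 N θ Mstar 𝔮 𝔮s h𝔮 h𝔮s 𝔯) 𝔈 x).Cinv ∧
      (opsYNuStOfRecordV10E N θ Mstar 𝔮 𝔮s h𝔮 h𝔮s 𝔯 𝔢 𝔴 𝔈 x).GD = (opsYOfLetters N θ Mstar (lettersYOfRecordV10 N θ Mstar 𝔮 𝔮s h𝔮 h𝔮s 𝔯) 𝔈 x).GD ∧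
      (opsYNuStOfRecordV10E N θ Mstar 𝔮 𝔮s h𝔮 h𝔮s 𝔯 𝔢 𝔴 𝔈 x).G₁ = (opsYOfLetters N θ Mstar (lettersYOfRecordV10 N θ Mstar 𝔮 𝔮s h𝔮 h𝔮s 𝔯) 𝔈 x).G₁ ∧
      (opsYNuStOfRecordV10E N θ Mstar 𝔮 𝔮s h𝔮 h𝔮s 𝔯 𝔢 𝔴 𝔈 x).H = (opsYOfLetters N θ Mstar (lettersYOfRecordV10 N θ Mstar 𝔮 𝔮s h𝔮 h𝔮s 𝔯) 𝔈 x).H ∧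
      (opsYNuStOfRecordV10E N θ Mstar 𝔮 𝔮s h𝔮 h𝔮s 𝔯 𝔢 𝔴 𝔈 x).H₁ = (opsYOfLetters N θ Mstar (lettersYOfRecordV10 N θ Mstar 𝔮 𝔮s h𝔮 h𝔮s 𝔯) 𝔈 x).H₁ ∧
      (opsYNuStOfRecordV10E N θ Mstar 𝔮 𝔮s h𝔮 h𝔮s 𝔯 𝔢 𝔴 𝔈 x).GG = (opsYOfLetters N θ Mstar (lettersYOfRecordV10 N θ Mstar 𝔮 𝔮s h𝔮 h𝔮s 𝔯) 𝔈 x).GG ∧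
      (opsYNuStOfRecordV10E N θ Mstar 𝔮 𝔮s h𝔮 h𝔮s 𝔯 𝔢 𝔴 𝔈 x).Kdiff =
        (opsYOfLetters N θ Mstar (lettersYOfRecordV10 N θ Mstar 𝔮 𝔮s h𝔮 h𝔮s 𝔯) 𝔈 x).Kdiff :=
  ⟨rfl, rfl, rfl, rfl, rfl, rfl, rfl, rfl, rfl⟩

/-- ★ ROW 26's two kernels at the `ν`-read v10 star instance ARE the `ν`-readings of the genuine `(𝔮G̃𝔮⋆)⁻¹ ∕ (𝔮G₁𝔮⋆)⁻¹` OVER THE PAIR, FED `G′_phys`.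
[cite: Balaban1985BackgroundPropagators, (3.132) p.422, (3.123) p.420, (3.129) p.421, bookkeeping] -/
theorem opsYNuStOfRecordV10E_QGQinv_QG1Qinv (x : MemberY θ.d₆ θ.ℓ₆ θ.hd' θ.hL' θ.b₀ θ.b₁ Mstar) :
    (opsYNuStOfRecordV10E N θ Mstar 𝔮 𝔮s h𝔮 h𝔮s 𝔯 𝔢 𝔴 𝔈 x).QGQinv =
        siteKernelOfOpNu x.toKIdx (bg9Y (Matrix (Fin N) (Fin N) ℂ) (specialUnitaryUnits (Fin N)) x) (fun U => U) (nuY (θ.d₆ + 1) x.toKIdx)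
          (QGQinvQY x.toKIdx (𝔮 x.toKIdx) (𝔮s x.toKIdx) (parSymY x.toKIdx) (GpPhysY x.toKIdx (parSymY x.toKIdx))) ∧
      (opsYNuStOfRecordV10E N θ Mstar 𝔮 𝔮s h𝔮 h𝔮s 𝔯 𝔢 𝔴 𝔈 x).QG1Qinv =
        siteKernelOfOpNu x.toKIdx (bg9Y (Matrix (Fin N) (Fin N) ℂ) (specialUnitaryUnits (Fin N)) x) (fun U => U) (nuY (θ.d₆ + 1) x.toKIdx)
          (QG1QinvQY x.toKIdx (𝔮 x.toKIdx) (𝔮s x.toKIdx) (parSymY x.toKIdx) (GpPhysY x.toKIdx (parSymY x.toKIdx)) (𝔯 x).Δ2) :=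
  ⟨rfl, rfl⟩

/-- ★ ROWS 24–25 at both v10 star instances: `Ck` = the index-bond reading of the STAR `C^{(k)}(Λ; U) = CkStY` OVER THE v10 LETTERS OF RECORD (whose `δK`
(3.157) carries the pair's `(𝔮G₁𝔮⋆)⁻¹`) and the star letters `𝔢 x`; `GivenBy3185 = givenBy3185stY`, `HasRWExpC = hasRWExpCY (𝔴 x)`, `P349` = n06-i's site-(3.49)
reading (reads only `.Gp ∕ .parS` — pair-independent); the plain and the `ν`-read instance agree on these four.
[cite: Balaban1985BackgroundPropagators, Thm 3.15 (3.185)–(3.187) p.432, (3.157)–(3.158) p.428, (3.49) p.399, bookkeeping] -/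
theorem opsYNuStOfRecordV10E_sectE (x : MemberY θ.d₆ θ.ℓ₆ θ.hd' θ.hL' θ.b₀ θ.b₁ Mstar) :
    (opsYNuStOfRecordV10E N θ Mstar 𝔮 𝔮s h𝔮 h𝔮s 𝔯 𝔢 𝔴 𝔈 x).Ck =
        siteKernelOfOp x.toKIdx (bg9Y (Matrix (Fin N) (Fin N) ℂ) (specialUnitaryUnits (Fin N)) x) (fun U => U)
          (CkStY x (lettersYOfRecordV10 N θ Mstar 𝔮 𝔮s h𝔮 h𝔮s 𝔯 x) (𝔢 x)) id id ∧
      (opsYNuStOfRecordV10E N θ Mstar 𝔮 𝔮s h𝔮 h𝔮s 𝔯 𝔢 𝔴 𝔈 x).GivenBy3185 =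
        givenBy3185stY x (lettersYOfRecordV10 N θ Mstar 𝔮 𝔮s h𝔮 h𝔮s 𝔯 x) (𝔢 x) ∧
      (opsYNuStOfRecordV10E N θ Mstar 𝔮 𝔮s h𝔮 h𝔮s 𝔯 𝔢 𝔴 𝔈 x).HasRWExpC = hasRWExpCY (𝔴 x) ∧
      (opsYNuStOfRecordV10E N θ Mstar 𝔮 𝔮s h𝔮 h𝔮s 𝔯 𝔢 𝔴 𝔈 x).P349 =
        p349SiteY (Matrix (Fin N) (Fin N) ℂ) (specialUnitaryUnits (Fin N)) x (lettersYOfRecordV10 N θ Mstar 𝔮 𝔮s h𝔮 h𝔮s 𝔯 x) ∧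
      (opsYNuStOfRecordV10E N θ Mstar 𝔮 𝔮s h𝔮 h𝔮s 𝔯 𝔢 𝔴 𝔈 x).P349 =
        fineKernelOfSiteOp x.toKIdx (bg9Y (Matrix (Fin N) (Fin N) ℂ) (specialUnitaryUnits (Fin N)) x) (fun U => U)
          (P349Y x.toKIdx (parSymY x.toKIdx) (GpY x.toKIdx (parSymY x.toKIdx))) ∧
      (opsYStOfRecordV10E N θ Mstar 𝔮 𝔮s h𝔮 h𝔮s 𝔯 𝔢 𝔴 𝔈 x).Ck = (opsYNuStOfRecordV10E N θ Mstar 𝔮 𝔮s h𝔮 h𝔮s 𝔯 𝔢 𝔴 𝔈 x).Ck ∧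
      (opsYStOfRecordV10E N θ Mstar 𝔮 𝔮s h𝔮 h𝔮s 𝔯 𝔢 𝔴 𝔈 x).GivenBy3185 =
        (opsYNuStOfRecordV10E N θ Mstar 𝔮 𝔮s h𝔮 h𝔮s 𝔯 𝔢 𝔴 𝔈 x).GivenBy3185 ∧
      (opsYStOfRecordV10E N θ Mstar 𝔮 𝔮s h𝔮 h𝔮s 𝔯 𝔢 𝔴 𝔈 x).HasRWExpC =
        (opsYNuStOfRecordV10E N θ Mstar 𝔮 𝔮s h𝔮 h𝔮s 𝔯 𝔢 𝔴 𝔈 x).HasRWExpC ∧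
      (opsYStOfRecordV10E N θ Mstar 𝔮 𝔮s h𝔮 h𝔮s 𝔯 𝔢 𝔴 𝔈 x).P349 = (opsYNuStOfRecordV10E N θ Mstar 𝔮 𝔮s h𝔮 h𝔮s 𝔯 𝔢 𝔴 𝔈 x).P349 :=
  ⟨rfl, rfl, rfl, rfl, rfl, rfl, rfl, rfl, rfl⟩

/-- ★ ROW 24's kernel ENTRY at the `ν`-read v10 star instance: the sup over the unit ball of the STAR `C^{(k)}(Λ; U)` over the v10 letters, applied to a bond delta.
[cite: Balaban1985BackgroundPropagators, Thm 3.15 (3.187) p.432, bookkeeping] -/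
theorem opsYNuStOfRecordV10E_Ck_ker (x : MemberY θ.d₆ θ.ℓ₆ θ.hd' θ.hL' θ.b₀ θ.b₁ Mstar)
    (U : (bg9Y (Matrix (Fin N) (Fin N) ℂ) (specialUnitaryUnits (Fin N)) x).Cfg) (y y' : (geo9Y x).Site) :
    (opsYNuStOfRecordV10E N θ Mstar 𝔮 𝔮s h𝔮 h𝔮s 𝔯 𝔢 𝔴 𝔈 x).Ck.ker U y y' =
      ⨆ E : BallY (Matrix (Fin N) (Fin N) ℂ),
        ‖CkStY x (lettersYOfRecordV10 N θ Mstar 𝔮 𝔮s h𝔮 h𝔮s 𝔯 x) (𝔢 x) U (deltaY y' (E : Matrix (Fin N) (Fin N) ℂ)) y‖ := rfl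

/-- ★ the predicate ∕ expansion fields of both v10 star instances are `𝔈`'s (rows 1–3, 13–16, 18–19 transport by `rfl`).
[cite: Balaban1985BackgroundPropagators, Thms 3.4–3.13 pp.400–426, bookkeeping] -/
theorem opsYNuStOfRecordV10E_preds (x : MemberY θ.d₆ θ.ℓ₆ θ.hd' θ.hL' θ.b₀ θ.b₁ Mstar) :
    (opsYNuStOfRecordV10E N θ Mstar 𝔮 𝔮s h𝔮 h𝔮s 𝔯 𝔢 𝔴 𝔈 x).IsAnalyticExt = (𝔈 x).IsAnalyticExt ∧
      (opsYNuStOfRecordV10E N θ Mstar 𝔮 𝔮s h𝔮 h𝔮s 𝔯 𝔢 𝔴 𝔈 x).E37 = (𝔈 x).E37 ∧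
      (opsYNuStOfRecordV10E N θ Mstar 𝔮 𝔮s h𝔮 h𝔮s 𝔯 𝔢 𝔴 𝔈 x).EK39 = (𝔈 x).EK39 ∧
      (opsYNuStOfRecordV10E N θ Mstar 𝔮 𝔮s h𝔮 h𝔮s 𝔯 𝔢 𝔴 𝔈 x).E310 = (𝔈 x).E310 ∧
      (opsYNuStOfRecordV10E N θ Mstar 𝔮 𝔮s h𝔮 h𝔮s 𝔯 𝔢 𝔴 𝔈 x).PosDef = (𝔈 x).PosDef ∧
      (opsYNuStOfRecordV10E N θ Mstar 𝔮 𝔮s h𝔮 h𝔮s 𝔯 𝔢 𝔴 𝔈 x).HasRWExp = (𝔈 x).HasRWExp ∧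
      (opsYNuStOfRecordV10E N θ Mstar 𝔮 𝔮s h𝔮 h𝔮s 𝔯 𝔢 𝔴 𝔈 x).HasRWExpH = (𝔈 x).HasRWExpH ∧
      (opsYNuStOfRecordV10E N θ Mstar 𝔮 𝔮s h𝔮 h𝔮s 𝔯 𝔢 𝔴 𝔈 x).PosDefK = (𝔈 x).PosDefK ∧
      (opsYStOfRecordV10E N θ Mstar 𝔮 𝔮s h𝔮 h𝔮s 𝔯 𝔢 𝔴 𝔈 x).IsAnalyticExt = (𝔈 x).IsAnalyticExt ∧
      (opsYStOfRecordV10E N θ Mstar 𝔮 𝔮s h𝔮 h𝔮s 𝔯 𝔢 𝔴 𝔈 x).E37 = (𝔈 x).E37 ∧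
      (opsYStOfRecordV10E N θ Mstar 𝔮 𝔮s h𝔮 h𝔮s 𝔯 𝔢 𝔴 𝔈 x).EK39 = (𝔈 x).EK39 ∧
      (opsYStOfRecordV10E N θ Mstar 𝔮 𝔮s h𝔮 h𝔮s 𝔯 𝔢 𝔴 𝔈 x).E310 = (𝔈 x).E310 ∧
      (opsYStOfRecordV10E N θ Mstar 𝔮 𝔮s h𝔮 h𝔮s 𝔯 𝔢 𝔴 𝔈 x).PosDef = (𝔈 x).PosDef ∧
      (opsYStOfRecordV10E N θ Mstar 𝔮 𝔮s h𝔮 h𝔮s 𝔯 𝔢 𝔴 𝔈 x).HasRWExp = (𝔈 x).HasRWExp ∧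
      (opsYStOfRecordV10E N θ Mstar 𝔮 𝔮s h𝔮 h𝔮s 𝔯 𝔢 𝔴 𝔈 x).HasRWExpH = (𝔈 x).HasRWExpH ∧
      (opsYStOfRecordV10E N θ Mstar 𝔮 𝔮s h𝔮 h𝔮s 𝔯 𝔢 𝔴 𝔈 x).PosDefK = (𝔈 x).PosDefK :=
  ⟨rfl, rfl, rfl, rfl, rfl, rfl, rfl, rfl, rfl, rfl, rfl, rfl, rfl, rfl, rfl, rfl⟩

/-- the [B9] bundle of record at the `ν`-read v10 star instance. [cite: Balaban1985BackgroundPropagators, Thms 3.1–3.15 pp.397–432, bookkeeping] -/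
theorem Y9OfRecord_opsYNuStOfRecordV10E :
    Y9OfRecord N θ Mstar (opsYNuStOfRecordV10E N θ Mstar 𝔮 𝔮s h𝔮 h𝔮s 𝔯 𝔢 𝔴 𝔈) =
      carriersY θ.d₆ θ.ℓ₆ θ.hd' θ.hL' θ.b₀ θ.b₁ Mstar (Matrix (Fin N) (Fin N) ℂ) (specialUnitaryUnits (Fin N))
        (opsYNuStOfRecordV10E N θ Mstar 𝔮 𝔮s h𝔮 h𝔮s 𝔯 𝔢 𝔴 𝔈) := rfl

/-- the [B9] bundle of record at the plain v10 star instance. [cite: Balaban1985BackgroundPropagators, Thms 3.1–3.15 pp.397–432, bookkeeping] -/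
theorem Y9OfRecord_opsYStOfRecordV10E :
    Y9OfRecord N θ Mstar (opsYStOfRecordV10E N θ Mstar 𝔮 𝔮s h𝔮 h𝔮s 𝔯 𝔢 𝔴 𝔈) =
      carriersY θ.d₆ θ.ℓ₆ θ.hd' θ.hL' θ.b₀ θ.b₁ Mstar (Matrix (Fin N) (Fin N) ℂ) (specialUnitaryUnits (Fin N))
        (opsYStOfRecordV10E N θ Mstar 𝔮 𝔮s h𝔮 h𝔮s 𝔯 𝔢 𝔴 𝔈) := rfl

/-- at the FLAT star Sect. E family the `ν`-read v10 star instance's `Ck` kernel vanishes identically (row 24's honesty guard, first half).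
[cite: Balaban1985BackgroundPropagators, Thm 3.15 (3.187) p.432, bookkeeping] -/
theorem opsYNuStOfRecordV10E_Ck_ker_flat (x : MemberY θ.d₆ θ.ℓ₆ θ.hd' θ.hL' θ.b₀ θ.b₁ Mstar)
    (U : (bg9Y (Matrix (Fin N) (Fin N) ℂ) (specialUnitaryUnits (Fin N)) x).Cfg) (y y' : (geo9Y x).Site) :
    (opsYNuStOfRecordV10E N θ Mstar 𝔮 𝔮s h𝔮 h𝔮s 𝔯 (sectEStY_flat N θ Mstar) 𝔴 𝔈 x).Ck.ker U y y' = 0 :=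
  operatorLayerYSectESt_Ck_ker_flat x (opsYS349NuOfLetters N θ Mstar (lettersYOfRecordV10 N θ Mstar 𝔮 𝔮s h𝔮 h𝔮s 𝔯) 𝔈 x)
    (lettersYOfRecordV10 N θ Mstar 𝔮 𝔮s h𝔮 h𝔮s 𝔯 x) (𝔴 x) U y y'

/-- at the FLAT star Sect. E family the plain v10 star instance's `Ck` kernel vanishes identically. [cite: Balaban1985BackgroundPropagators, Thm 3.15 (3.187) p.432, bookkeeping] -/
theorem opsYStOfRecordV10E_Ck_ker_flat (x : MemberY θ.d₆ θ.ℓ₆ θ.hd' θ.hL' θ.b₀ θ.b₁ Mstar)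
    (U : (bg9Y (Matrix (Fin N) (Fin N) ℂ) (specialUnitaryUnits (Fin N)) x).Cfg) (y y' : (geo9Y x).Site) :
    (opsYStOfRecordV10E N θ Mstar 𝔮 𝔮s h𝔮 h𝔮s 𝔯 (sectEStY_flat N θ Mstar) 𝔴 𝔈 x).Ck.ker U y y' = 0 :=
  operatorLayerYSectESt_Ck_ker_flat x (opsYS349OfLetters N θ Mstar (lettersYOfRecordV10 N θ Mstar 𝔮 𝔮s h𝔮 h𝔮s 𝔯) 𝔈 x)
    (lettersYOfRecordV10 N θ Mstar 𝔮 𝔮s h𝔮 h𝔮s 𝔯 x) (𝔴 x) U y y'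

/-- ★ **ROW 24 (`t315`) AT THE `ν`-READ v10 STAR INSTANCE, UNFOLDED** (`Iff.rfl`) — the named binder a certificate displays for row 24: the printed Theorem 3.15
about the index-bond kernel of the STAR `C^{(k)}(Λ; U) = CkStY` over the v10 letters of record and the star letters `𝔢`, «given by (3.185)» = `givenBy3185stY`,
the expansion clause = `hasRWExpCY (𝔴 x)`. [cite: Balaban1985BackgroundPropagators, Thm 3.15 (3.185)–(3.187) p.432] -/
theorem t315_opsYNuStOfRecordV10E_iff :
    B9.Thm315FullPrinted c35Y geo9Y (bg9Y (Matrix (Fin N) (Fin N) ℂ) (specialUnitaryUnits (Fin N)))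
        (fun x => (opsYNuStOfRecordV10E N θ Mstar 𝔮 𝔮s h𝔮 h𝔮s 𝔯 𝔢 𝔴 𝔈 x).Ck) inΛY unitDistY
        (fun x => (opsYNuStOfRecordV10E N θ Mstar 𝔮 𝔮s h𝔮 h𝔮s 𝔯 𝔢 𝔴 𝔈 x).GivenBy3185)
        (fun x => (opsYNuStOfRecordV10E N θ Mstar 𝔮 𝔮s h𝔮 h𝔮s 𝔯 𝔢 𝔴 𝔈 x).HasRWExpC) ↔
      B9.Thm315FullPrinted c35Y geo9Y (bg9Y (Matrix (Fin N) (Fin N) ℂ) (specialUnitaryUnits (Fin N)))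
        (fun x => siteKernelOfOp x.toKIdx (bg9Y (Matrix (Fin N) (Fin N) ℂ) (specialUnitaryUnits (Fin N)) x) (fun U => U)
          (CkStY x (lettersYOfRecordV10 N θ Mstar 𝔮 𝔮s h𝔮 h𝔮s 𝔯 x) (𝔢 x)) id id) inΛY unitDistY
        (fun x => givenBy3185stY x (lettersYOfRecordV10 N θ Mstar 𝔮 𝔮s h𝔮 h𝔮s 𝔯 x) (𝔢 x)) (fun x => hasRWExpCY (𝔴 x)) := Iff.rfl

/-- ROW 24 (`t315`) at the plain v10 star instance, unfolded (`Iff.rfl`). [cite: Balaban1985BackgroundPropagators, Thm 3.15 (3.185)–(3.187) p.432] -/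
theorem t315_opsYStOfRecordV10E_iff :
    B9.Thm315FullPrinted c35Y geo9Y (bg9Y (Matrix (Fin N) (Fin N) ℂ) (specialUnitaryUnits (Fin N)))
        (fun x => (opsYStOfRecordV10E N θ Mstar 𝔮 𝔮s h𝔮 h𝔮s 𝔯 𝔢 𝔴 𝔈 x).Ck) inΛY unitDistY
        (fun x => (opsYStOfRecordV10E N θ Mstar 𝔮 𝔮s h𝔮 h𝔮s 𝔯 𝔢 𝔴 𝔈 x).GivenBy3185)
        (fun x => (opsYStOfRecordV10E N θ Mstar 𝔮 𝔮s h𝔮 h𝔮s 𝔯 𝔢 𝔴 𝔈 x).HasRWExpC) ↔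
      B9.Thm315FullPrinted c35Y geo9Y (bg9Y (Matrix (Fin N) (Fin N) ℂ) (specialUnitaryUnits (Fin N)))
        (fun x => siteKernelOfOp x.toKIdx (bg9Y (Matrix (Fin N) (Fin N) ℂ) (specialUnitaryUnits (Fin N)) x) (fun U => U)
          (CkStY x (lettersYOfRecordV10 N θ Mstar 𝔮 𝔮s h𝔮 h𝔮s 𝔯 x) (𝔢 x)) id id) inΛY unitDistY
        (fun x => givenBy3185stY x (lettersYOfRecordV10 N θ Mstar 𝔮 𝔮s h𝔮 h𝔮s 𝔯 x) (𝔢 x)) (fun x => hasRWExpCY (𝔴 x)) := Iff.rfl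

/-- ROW 24 at the plain v10 star instance IS row 24 at the `ν`-read one (the three Sect. E fields agree, `Iff.rfl`). [cite: Balaban1985BackgroundPropagators, Thm 3.15 p.432, bookkeeping] -/
theorem t315_opsYStOfRecordV10E_iff_nu :
    B9.Thm315FullPrinted c35Y geo9Y (bg9Y (Matrix (Fin N) (Fin N) ℂ) (specialUnitaryUnits (Fin N)))
        (fun x => (opsYStOfRecordV10E N θ Mstar 𝔮 𝔮s h𝔮 h𝔮s 𝔯 𝔢 𝔴 𝔈 x).Ck) inΛY unitDistY
        (fun x => (opsYStOfRecordV10E N θ Mstar 𝔮 𝔮s h𝔮 h𝔮s 𝔯 𝔢 𝔴 𝔈 x).GivenBy3185)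
        (fun x => (opsYStOfRecordV10E N θ Mstar 𝔮 𝔮s h𝔮 h𝔮s 𝔯 𝔢 𝔴 𝔈 x).HasRWExpC) ↔
      B9.Thm315FullPrinted c35Y geo9Y (bg9Y (Matrix (Fin N) (Fin N) ℂ) (specialUnitaryUnits (Fin N)))
        (fun x => (opsYNuStOfRecordV10E N θ Mstar 𝔮 𝔮s h𝔮 h𝔮s 𝔯 𝔢 𝔴 𝔈 x).Ck) inΛY unitDistY
        (fun x => (opsYNuStOfRecordV10E N θ Mstar 𝔮 𝔮s h𝔮 h𝔮s 𝔯 𝔢 𝔴 𝔈 x).GivenBy3185)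
        (fun x => (opsYNuStOfRecordV10E N θ Mstar 𝔮 𝔮s h𝔮 h𝔮s 𝔯 𝔢 𝔴 𝔈 x).HasRWExpC) := Iff.rfl

/-- THE HONESTY GUARD at v10: at the FLAT star Sect. E family and the FLAT walk letters row 24 holds OUTRIGHT at the `ν`-read v10 star instance (kernel `0`,
both slots trivially inhabited) — content enters exactly with GENUINE star letters, never by the typing alone. [cite: Balaban1985BackgroundPropagators, Thm 3.15 (3.185)–(3.187) p.432, bookkeeping] -/
theorem t315_opsYNuStOfRecordV10E_flat {δ₀ : ℝ} (hδ₀ : 0 < δ₀) :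
    B9.Thm315FullPrinted c35Y geo9Y (bg9Y (Matrix (Fin N) (Fin N) ℂ) (specialUnitaryUnits (Fin N)))
      (fun x => (opsYNuStOfRecordV10E N θ Mstar 𝔮 𝔮s h𝔮 h𝔮s 𝔯 (sectEStY_flat N θ Mstar) (rwEY_flat N θ Mstar) 𝔈 x).Ck) inΛY unitDistY
      (fun x => (opsYNuStOfRecordV10E N θ Mstar 𝔮 𝔮s h𝔮 h𝔮s 𝔯 (sectEStY_flat N θ Mstar) (rwEY_flat N θ Mstar) 𝔈 x).GivenBy3185)
      (fun x => (opsYNuStOfRecordV10E N θ Mstar 𝔮 𝔮s h𝔮 h𝔮s 𝔯 (sectEStY_flat N θ Mstar) (rwEY_flat N θ Mstar) 𝔈 x).HasRWExpC) :=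
  ⟨δ₀, 1, 1, hδ₀, one_pos, one_pos, fun x _ _ _ U _ _ =>
    ⟨givenBy3185stY_flat x _ U, hasRWExpCY_flat _ _ x U δ₀, fun y y' _ _ => by
      rw [opsYNuStOfRecordV10E_Ck_ker_flat, abs_zero]
      exact mul_nonneg zero_le_one (Real.exp_nonneg _)⟩⟩

/-- the honesty guard at the plain v10 star instance. [cite: Balaban1985BackgroundPropagators, Thm 3.15 (3.185)–(3.187) p.432, bookkeeping] -/
theorem t315_opsYStOfRecordV10E_flat {δ₀ : ℝ} (hδ₀ : 0 < δ₀) :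
    B9.Thm315FullPrinted c35Y geo9Y (bg9Y (Matrix (Fin N) (Fin N) ℂ) (specialUnitaryUnits (Fin N)))
      (fun x => (opsYStOfRecordV10E N θ Mstar 𝔮 𝔮s h𝔮 h𝔮s 𝔯 (sectEStY_flat N θ Mstar) (rwEY_flat N θ Mstar) 𝔈 x).Ck) inΛY unitDistY
      (fun x => (opsYStOfRecordV10E N θ Mstar 𝔮 𝔮s h𝔮 h𝔮s 𝔯 (sectEStY_flat N θ Mstar) (rwEY_flat N θ Mstar) 𝔈 x).GivenBy3185)
      (fun x => (opsYStOfRecordV10E N θ Mstar 𝔮 𝔮s h𝔮 h𝔮s 𝔯 (sectEStY_flat N θ Mstar) (rwEY_flat N θ Mstar) 𝔈 x).HasRWExpC) :=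
  (t315_opsYStOfRecordV10E_iff_nu N θ Mstar 𝔮 𝔮s h𝔮 h𝔮s 𝔯 _ _ 𝔈).2 (t315_opsYNuStOfRecordV10E_flat N θ Mstar 𝔮 𝔮s h𝔮 h𝔮s 𝔯 𝔈 hδ₀)

/-! ### Row 24 KEYED BY NAME to the v10 star instances at the v7 star record `sectEStYOfRecordV7 … 𝔢₀` (one-line instances of `B9Thm315SectEStarRepAtLettersR` §5) -/

variable (𝔢₀ : SectEY N θ Mstar)

/-- ★★★ **ROW 24 AT THE `ν`-READ v10 STAR RECORD `opsYNuStOfRecordV10E … 𝔯 (sectEStYOfRecordV7 … 𝔢₀) 𝔴 𝔈` OVER `bg9Y ∕ c35Y`** from the three displayed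
conjuncts `givenBy3185stY ∧ hasRWExpCY ∧ DecayMidOnStY` at the v10 letters of record, locality PROVED.
[cite: Balaban1985BackgroundPropagators, Thm 3.15 (3.185)–(3.187) p.432, (3.157) p.428] -/
theorem t315_opsYNuStOfRecordV10E_sectEStYOfRecordV7_of_3185_on {a₀ δ₁ B₁ : ℝ} (ha₀ : 0 < a₀) (hδ₁ : 0 < δ₁) (hB₁ : 0 < B₁)
    (h : ∀ (x : MemberY θ.d₆ θ.ℓ₆ θ.hd' θ.hL' θ.b₀ θ.b₁ Mstar) (α₀ : ℝ), 0 < α₀ → (geo9Y x).M * α₀ ≤ a₀ →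
      ∀ U : (bg9Y (Matrix (Fin N) (Fin N) ℂ) (specialUnitaryUnits (Fin N)) x).Cfg,
        (bg9Y (Matrix (Fin N) (Fin N) ℂ) (specialUnitaryUnits (Fin N)) x).Reg335 c35Y α₀ U →
        (bg9Y (Matrix (Fin N) (Fin N) ℂ) (specialUnitaryUnits (Fin N)) x).Reg336 c35Y α₀ U →
          givenBy3185stY x (lettersYOfRecordV10 N θ Mstar 𝔮 𝔮s h𝔮 h𝔮s 𝔯 x) (sectEStYOfRecordV7 N θ Mstar 𝔢₀ x) U ∧ hasRWExpCY (𝔴 x) U δ₁ ∧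
            DecayMidOnStY x (lettersYOfRecordV10 N θ Mstar 𝔮 𝔮s h𝔮 h𝔮s 𝔯 x) (sectEStYOfRecordV7 N θ Mstar 𝔢₀ x) B₁ U δ₁) :
    B9.Thm315FullPrinted c35Y geo9Y (bg9Y (Matrix (Fin N) (Fin N) ℂ) (specialUnitaryUnits (Fin N)))
      (fun x => (opsYNuStOfRecordV10E N θ Mstar 𝔮 𝔮s h𝔮 h𝔮s 𝔯 (sectEStYOfRecordV7 N θ Mstar 𝔢₀) 𝔴 𝔈 x).Ck) inΛY unitDistY
      (fun x => (opsYNuStOfRecordV10E N θ Mstar 𝔮 𝔮s h𝔮 h𝔮s 𝔯 (sectEStYOfRecordV7 N θ Mstar 𝔢₀) 𝔴 𝔈 x).GivenBy3185)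
      (fun x => (opsYNuStOfRecordV10E N θ Mstar 𝔮 𝔮s h𝔮 h𝔮s 𝔯 (sectEStYOfRecordV7 N θ Mstar 𝔢₀) 𝔴 𝔈 x).HasRWExpC) :=
  t315_opsYSectESt_sectEStYOfRecordV7_of_3185_on N θ Mstar 𝔢₀
    (opsYS349NuOfLetters N θ Mstar (lettersYOfRecordV10 N θ Mstar 𝔮 𝔮s h𝔮 h𝔮s 𝔯) 𝔈) (lettersYOfRecordV10 N θ Mstar 𝔮 𝔮s h𝔮 h𝔮s 𝔯) 𝔴 ha₀ hδ₁ hB₁ h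

variable {R₁ R₂ : RegFamY θ.d₆ θ.ℓ₆ θ.hd' θ.hL' θ.b₀ θ.b₁ Mstar (Matrix (Fin N) (Fin N) ℂ)}

/-- ★★★ **ROW 24 AT THE `ν`-READ v10 STAR RECORD OVER THE CLASS-PARAMETRIC CARRIER `bg9YR … R₁ R₂` AT GENERIC `c`** (special-unitary member family `hGR`)
from the three displayed conjuncts, locality PROVED — the v10 twin, keyed by name, of the N06 certificate of record's `have t315 := …_onR …` step.
[cite: Balaban1985BackgroundPropagators, Thm 3.15 (3.185)–(3.187) p.432, (3.157) p.428, (3.35)–(3.36) p.396; Balaban1984PropagatorsII, (2.3) p.224] -/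
theorem t315_opsYNuStOfRecordV10E_sectEStYOfRecordV7_of_3185_onR (hGR : MemOfFam (specialUnitaryUnits (Fin N)) R₁) {c a₀ δ₁ B₁ : ℝ}
    (ha₀ : 0 < a₀) (hδ₁ : 0 < δ₁) (hB₁ : 0 < B₁)
    (h : ∀ (x : MemberY θ.d₆ θ.ℓ₆ θ.hd' θ.hL' θ.b₀ θ.b₁ Mstar) (α₀ : ℝ), 0 < α₀ → (geo9Y x).M * α₀ ≤ a₀ →
      ∀ U : (bg9YR (Matrix (Fin N) (Fin N) ℂ) (specialUnitaryUnits (Fin N)) R₁ R₂ x).Cfg,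
        (bg9YR (Matrix (Fin N) (Fin N) ℂ) (specialUnitaryUnits (Fin N)) R₁ R₂ x).Reg335 c α₀ U →
        (bg9YR (Matrix (Fin N) (Fin N) ℂ) (specialUnitaryUnits (Fin N)) R₁ R₂ x).Reg336 c α₀ U →
          givenBy3185stY x (lettersYOfRecordV10 N θ Mstar 𝔮 𝔮s h𝔮 h𝔮s 𝔯 x) (sectEStYOfRecordV7 N θ Mstar 𝔢₀ x) U ∧ hasRWExpCY (𝔴 x) U δ₁ ∧
            DecayMidOnStY x (lettersYOfRecordV10 N θ Mstar 𝔮 𝔮s h𝔮 h𝔮s 𝔯 x) (sectEStYOfRecordV7 N θ Mstar 𝔢₀ x) B₁ U δ₁) :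
    B9.Thm315FullPrinted c geo9Y (bg9YR (Matrix (Fin N) (Fin N) ℂ) (specialUnitaryUnits (Fin N)) R₁ R₂)
      (fun x => siteKernelR R₁ R₂ (opsYNuStOfRecordV10E N θ Mstar 𝔮 𝔮s h𝔮 h𝔮s 𝔯 (sectEStYOfRecordV7 N θ Mstar 𝔢₀) 𝔴 𝔈 x).Ck) inΛY unitDistY
      (fun x => (opsYNuStOfRecordV10E N θ Mstar 𝔮 𝔮s h𝔮 h𝔮s 𝔯 (sectEStYOfRecordV7 N θ Mstar 𝔢₀) 𝔴 𝔈 x).GivenBy3185)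
      (fun x => (opsYNuStOfRecordV10E N θ Mstar 𝔮 𝔮s h𝔮 h𝔮s 𝔯 (sectEStYOfRecordV7 N θ Mstar 𝔢₀) 𝔴 𝔈 x).HasRWExpC) :=
  t315_opsYSectESt_sectEStYOfRecordV7_of_3185_onR N θ Mstar 𝔢₀ hGR
    (opsYS349NuOfLetters N θ Mstar (lettersYOfRecordV10 N θ Mstar 𝔮 𝔮s h𝔮 h𝔮s 𝔯) 𝔈) (lettersYOfRecordV10 N θ Mstar 𝔮 𝔮s h𝔮 h𝔮s 𝔯) 𝔴 ha₀ hδ₁ hB₁ h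

/-- ★★ the same over the class-parametric carrier at the PLAIN v10 star record (row 24 does not see rows 25–26).
[cite: Balaban1985BackgroundPropagators, Thm 3.15 (3.185)–(3.187) p.432, (3.157) p.428, (3.35)–(3.36) p.396] -/
theorem t315_opsYStOfRecordV10E_sectEStYOfRecordV7_of_3185_onR (hGR : MemOfFam (specialUnitaryUnits (Fin N)) R₁) {c a₀ δ₁ B₁ : ℝ}
    (ha₀ : 0 < a₀) (hδ₁ : 0 < δ₁) (hB₁ : 0 < B₁)
    (h : ∀ (x : MemberY θ.d₆ θ.ℓ₆ θ.hd' θ.hL' θ.b₀ θ.b₁ Mstar) (α₀ : ℝ), 0 < α₀ → (geo9Y x).M * α₀ ≤ a₀ →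
      ∀ U : (bg9YR (Matrix (Fin N) (Fin N) ℂ) (specialUnitaryUnits (Fin N)) R₁ R₂ x).Cfg,
        (bg9YR (Matrix (Fin N) (Fin N) ℂ) (specialUnitaryUnits (Fin N)) R₁ R₂ x).Reg335 c α₀ U →
        (bg9YR (Matrix (Fin N) (Fin N) ℂ) (specialUnitaryUnits (Fin N)) R₁ R₂ x).Reg336 c α₀ U →
          givenBy3185stY x (lettersYOfRecordV10 N θ Mstar 𝔮 𝔮s h𝔮 h𝔮s 𝔯 x) (sectEStYOfRecordV7 N θ Mstar 𝔢₀ x) U ∧ hasRWExpCY (𝔴 x) U δ₁ ∧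
            DecayMidOnStY x (lettersYOfRecordV10 N θ Mstar 𝔮 𝔮s h𝔮 h𝔮s 𝔯 x) (sectEStYOfRecordV7 N θ Mstar 𝔢₀ x) B₁ U δ₁) :
    B9.Thm315FullPrinted c geo9Y (bg9YR (Matrix (Fin N) (Fin N) ℂ) (specialUnitaryUnits (Fin N)) R₁ R₂)
      (fun x => siteKernelR R₁ R₂ (opsYStOfRecordV10E N θ Mstar 𝔮 𝔮s h𝔮 h𝔮s 𝔯 (sectEStYOfRecordV7 N θ Mstar 𝔢₀) 𝔴 𝔈 x).Ck) inΛY unitDistY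
      (fun x => (opsYStOfRecordV10E N θ Mstar 𝔮 𝔮s h𝔮 h𝔮s 𝔯 (sectEStYOfRecordV7 N θ Mstar 𝔢₀) 𝔴 𝔈 x).GivenBy3185)
      (fun x => (opsYStOfRecordV10E N θ Mstar 𝔮 𝔮s h𝔮 h𝔮s 𝔯 (sectEStYOfRecordV7 N θ Mstar 𝔢₀) 𝔴 𝔈 x).HasRWExpC) :=
  t315_opsYSectESt_sectEStYOfRecordV7_of_3185_onR N θ Mstar 𝔢₀ hGR
    (opsYS349OfLetters N θ Mstar (lettersYOfRecordV10 N θ Mstar 𝔮 𝔮s h𝔮 h𝔮s 𝔯) 𝔈) (lettersYOfRecordV10 N θ Mstar 𝔮 𝔮s h𝔮 h𝔮s 𝔯) 𝔴 ha₀ hδ₁ hB₁ h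

end Record

/-! ## §4 ★ THE KNIT PAIR OF RECORD `(qKnitOfRecord, qsKnitOfRecord)`: its `U = 1` clauses, adjointness, letters ∕ instances of record and their faces -/

section RecordKnit

open scoped Matrix.Norms.L2Operator

/-- ★ the knit family of record is flat at `U = 1` (its `h𝔮` argument, by name: `isFlatQ_qKnitOfRecord`). [cite: Balaban1985Averaging, (15) p.19] [cite: Balaban1985BackgroundPropagators, Cor. 3.5 p.407] -/
theorem qKnitOfRecord_flat (N : ℕ) [Nonempty (Fin N)] (θ : Stage3Params) :
    ∀ i : KIdx θ.d₆ θ.ℓ₆ θ.hd' θ.hL' θ.b₀ θ.b₁, qKnitOfRecord N θ i (fun _ _ => 1) = liftMatY (Matrix (Fin N) (Fin N) ℂ) (qK i) :=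
  fun i => isFlatQ_qKnitOfRecord i

/-- ★★ **THE `U = 1` CLAUSE OF THE KNIT ADJOINT FAMILY OF RECORD**: `adjTrY (Q(1)) = lift q*` — at `U = 1` the knit letter IS the straight-contour letter
(`qKnitOfRecord_one_eq`), whose generic adjoint is the record's `Q*(1) = QsY parBY 1` (`adjTrY_QY_parBY`), the lift of `q*` (`QsY_one`).
[cite: Balaban1985BackgroundPropagators, (3.13) p.392, Cor. 3.5 p.407] [cite: Balaban1985Averaging, (15) p.19, (23) p.21] -/
theorem qsKnitOfRecord_one_eq {N : ℕ} [Nonempty (Fin N)] {θ : Stage3Params} (i : KIdx θ.d₆ θ.ℓ₆ θ.hd' θ.hL' θ.b₀ θ.b₁) :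
    qsKnitOfRecord N θ i (fun _ _ => 1) = liftMatY (Matrix (Fin N) (Fin N) ℂ) (qsK i) := by
  rw [qsKnitOfRecord_apply, ← qKnitOfRecord_apply (N := N) (θ := θ) i, qKnitOfRecord_one_eq i, qYOfRecord_apply,
    adjTrY_QY_parBY i (G := B7Prop2Explicit.unitaryUnits (Matrix (Fin N) (Fin N) ℂ)) le_rfl (U := fun _ _ => 1) fun _ _ => Subgroup.one_mem _]
  exact QsY_one i (parBY_one i)

/-- ★ the knit adjoint family of record is flat at `U = 1` (its `h𝔮⋆` argument, by name). [cite: Balaban1985BackgroundPropagators, (3.13) p.392, Cor. 3.5 p.407] [cite: Balaban1985Averaging, (15) p.19] -/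
theorem qsKnitOfRecord_flat (N : ℕ) [Nonempty (Fin N)] (θ : Stage3Params) :
    ∀ i : KIdx θ.d₆ θ.ℓ₆ θ.hd' θ.hL' θ.b₀ θ.b₁, qsKnitOfRecord N θ i (fun _ _ => 1) = liftMatY (Matrix (Fin N) (Fin N) ℂ) (qsK i) :=
  fun i => qsKnitOfRecord_one_eq i

/-- ★ **THE KNIT PAIR OF RECORD IS ADJOINT AT EVERY CONFIGURATION** (its second member IS the generic `trIP`-adjoint of the first).
[cite: Balaban1985BackgroundPropagators, (3.13) p.392, p.393 (Q* the adjoint of Q)] [cite: Balaban1985Averaging, (15) p.19] -/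
theorem isAdjTr_qKnitOfRecord {N : ℕ} [Nonempty (Fin N)] {θ : Stage3Params} (i : KIdx θ.d₆ θ.ℓ₆ θ.hd' θ.hL' θ.b₀ θ.b₁)
    (U : CfgY (Matrix (Fin N) (Fin N) ℂ) i) :
    IsAdjTr (fun _ => (1 : ℝ)) (fun _ => (1 : ℝ)) (qKnitOfRecord N θ i U) (qsKnitOfRecord N θ i U) :=
  isAdjTr_adjTrY _

/-- ★★★ **THE KNIT LETTERS OF RECORD** `:=` the v10 letters of record at the knit pair `(qKnitOfRecord, qsKnitOfRecord)` — print's `Q` of (3.115) in all nine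
`Q`-dependent letters. [cite: Balaban1985BackgroundPropagators, (3.115) p.418, (3.122)–(3.132) pp.420–422, (3.153) p.426] [cite: Balaban1985Averaging, (15)–(23) pp.19–21] -/
def lettersYOfRecordV10K (N : ℕ) [Nonempty (Fin N)] (θ : Stage3Params) (Mstar : ℕ) (𝔯 : ResY N θ Mstar) : LettersY N θ Mstar :=
  lettersYOfRecordV10 N θ Mstar (qKnitOfRecord N θ) (qsKnitOfRecord N θ) (qKnitOfRecord_flat N θ) (qsKnitOfRecord_flat N θ) 𝔯

/-- ★★★ **THE PLAIN v10 STAR INSTANCE OF RECORD AT THE KNIT PAIR.** [cite: Balaban1985BackgroundPropagators, Thms 3.1–3.15 pp.397–432, (3.115) p.418] [cite: Balaban1985Averaging, (15) p.19] -/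
def opsYStOfRecordV10KE (N : ℕ) [Nonempty (Fin N)] (θ : Stage3Params) (Mstar : ℕ) (𝔯 : ResY N θ Mstar) (𝔢 : SectEStY N θ Mstar)
    (𝔴 : RWEY N θ Mstar) (𝔈 : ExpsY N θ Mstar) : OpsY N θ Mstar :=
  opsYStOfRecordV10E N θ Mstar (qKnitOfRecord N θ) (qsKnitOfRecord N θ) (qKnitOfRecord_flat N θ) (qsKnitOfRecord_flat N θ) 𝔯 𝔢 𝔴 𝔈

/-- ★★★ **THE `ν`-READ v10 STAR INSTANCE OF RECORD AT THE KNIT PAIR** — the candidate object of a re-pinned N06 certificate (print's `Q` of (3.115) behind rows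
17, 20–26). [cite: Balaban1985BackgroundPropagators, Thms 3.1–3.15 pp.397–432, (3.115) p.418, (3.132) p.422] [cite: Balaban1985Averaging, (15) p.19] -/
def opsYNuStOfRecordV10KE (N : ℕ) [Nonempty (Fin N)] (θ : Stage3Params) (Mstar : ℕ) (𝔯 : ResY N θ Mstar) (𝔢 : SectEStY N θ Mstar)
    (𝔴 : RWEY N θ Mstar) (𝔈 : ExpsY N θ Mstar) : OpsY N θ Mstar :=
  opsYNuStOfRecordV10E N θ Mstar (qKnitOfRecord N θ) (qsKnitOfRecord N θ) (qKnitOfRecord_flat N θ) (qsKnitOfRecord_flat N θ) 𝔯 𝔢 𝔴 𝔈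

variable (N : ℕ) [Nonempty (Fin N)] (θ : Stage3Params) (Mstar : ℕ) (𝔯 : ResY N θ Mstar) (𝔢 : SectEStY N θ Mstar) (𝔴 : RWEY N θ Mstar)
  (𝔈 : ExpsY N θ Mstar)

/-- the knit letters of record ARE the v10 letters at the knit pair (`rfl`; every `lettersYOfRecordV10_…` face applies after this rewrite).
[cite: Balaban1985BackgroundPropagators, (3.115) p.418, bookkeeping] -/
theorem lettersYOfRecordV10K_eq : lettersYOfRecordV10K N θ Mstar 𝔯 =
    lettersYOfRecordV10 N θ Mstar (qKnitOfRecord N θ) (qsKnitOfRecord N θ) (qKnitOfRecord_flat N θ) (qsKnitOfRecord_flat N θ) 𝔯 := rfl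

/-- the plain knit instance IS the v10 instance at the knit pair (`rfl`; every `opsYStOfRecordV10E_…` face applies after this rewrite).
[cite: Balaban1985BackgroundPropagators, (3.115) p.418, Thm 3.15 p.432, bookkeeping] -/
theorem opsYStOfRecordV10KE_eq : opsYStOfRecordV10KE N θ Mstar 𝔯 𝔢 𝔴 𝔈 =
    opsYStOfRecordV10E N θ Mstar (qKnitOfRecord N θ) (qsKnitOfRecord N θ) (qKnitOfRecord_flat N θ) (qsKnitOfRecord_flat N θ) 𝔯 𝔢 𝔴 𝔈 := rfl

/-- the `ν`-read knit instance IS the v10 instance at the knit pair (`rfl`; every `opsYNuStOfRecordV10E_…` face applies after this rewrite).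
[cite: Balaban1985BackgroundPropagators, (3.115) p.418, (3.132) p.422, Thm 3.15 p.432, bookkeeping] -/
theorem opsYNuStOfRecordV10KE_eq : opsYNuStOfRecordV10KE N θ Mstar 𝔯 𝔢 𝔴 𝔈 =
    opsYNuStOfRecordV10E N θ Mstar (qKnitOfRecord N θ) (qsKnitOfRecord N θ) (qKnitOfRecord_flat N θ) (qsKnitOfRecord_flat N θ) 𝔯 𝔢 𝔴 𝔈 := rfl

/-- the plain knit instance as the star constructor over the knit letters (`rfl`). [cite: Balaban1985BackgroundPropagators, Thm 3.15 p.432, bookkeeping] -/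
theorem opsYStOfRecordV10KE_eq_opsYSectESt : opsYStOfRecordV10KE N θ Mstar 𝔯 𝔢 𝔴 𝔈 =
    opsYSectESt N θ Mstar (opsYS349OfLetters N θ Mstar (lettersYOfRecordV10K N θ Mstar 𝔯) 𝔈) (lettersYOfRecordV10K N θ Mstar 𝔯) 𝔢 𝔴 := rfl

/-- the `ν`-read knit instance as the star constructor over the knit letters (`rfl`). [cite: Balaban1985BackgroundPropagators, Thm 3.15 p.432, (3.132) p.422, bookkeeping] -/
theorem opsYNuStOfRecordV10KE_eq_opsYSectESt : opsYNuStOfRecordV10KE N θ Mstar 𝔯 𝔢 𝔴 𝔈 =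
    opsYSectESt N θ Mstar (opsYS349NuOfLetters N θ Mstar (lettersYOfRecordV10K N θ Mstar 𝔯) 𝔈) (lettersYOfRecordV10K N θ Mstar 𝔯) 𝔢 𝔴 := rfl

/-- the knit letters of record at a member (`rfl`). [cite: Balaban1985BackgroundPropagators, (3.115) p.418, (3.122)–(3.132) pp.420–422, bookkeeping] -/
theorem lettersYOfRecordV10K_apply (x : MemberY θ.d₆ θ.ℓ₆ θ.hd' θ.hL' θ.b₀ θ.b₁ Mstar) :
    lettersYOfRecordV10K N θ Mstar 𝔯 x = covLettersY_v10 (Matrix (Fin N) (Fin N) ℂ) x (qKnitOfRecord N θ) (qsKnitOfRecord N θ)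
      (qKnitOfRecord_flat N θ x.toKIdx) (qsKnitOfRecord_flat N θ x.toKIdx) (𝔯 x) := rfl

/-- the pair-independent letters of the knit record are the v4P record's (`rfl`). [cite: Balaban1985BackgroundPropagators, (3.19) p.393, (3.24)–(3.25) p.394, (3.48) p.398, bookkeeping] -/
theorem lettersYOfRecordV10K_base (x : MemberY θ.d₆ θ.ℓ₆ θ.hd' θ.hL' θ.b₀ θ.b₁ Mstar) :
    (lettersYOfRecordV10K N θ Mstar 𝔯 x).parS = parSymY x.toKIdx ∧ (lettersYOfRecordV10K N θ Mstar 𝔯 x).parB = parBY x.toKIdx ∧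
      (lettersYOfRecordV10K N θ Mstar 𝔯 x).Gp = GpY x.toKIdx (parSymY x.toKIdx) ∧
      (lettersYOfRecordV10K N θ Mstar 𝔯 x).C = (lettersYOfRecordV4P N θ Mstar 𝔯 x).C ∧
      (lettersYOfRecordV10K N θ Mstar 𝔯 x).P349 = (lettersYOfRecordV4P N θ Mstar 𝔯 x).P349 ∧
      (lettersYOfRecordV10K N θ Mstar 𝔯 x).Ck = (lettersYOfRecordV4P N θ Mstar 𝔯 x).Ck := ⟨rfl, rfl, rfl, rfl, rfl, rfl⟩

/-- ★ the Sect. B∕D∕E letters of the knit record, by name: the composites OVER THE KNIT PAIR `(QknitY, QknitY†)` fed `G′_phys`, and `GA` at lattice units.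
[cite: Balaban1985BackgroundPropagators, (3.27) p.395, (3.115) p.418, (3.122)–(3.132) pp.420–422, (3.153) p.426] [cite: Balaban1985Averaging, (15) p.19] -/
theorem lettersYOfRecordV10K_sectDE (x : MemberY θ.d₆ θ.ℓ₆ θ.hd' θ.hL' θ.b₀ θ.b₁ Mstar) :
    (lettersYOfRecordV10K N θ Mstar 𝔯 x).GD =
        GDQY x.toKIdx (qKnitOfRecord N θ x.toKIdx) (qsKnitOfRecord N θ x.toKIdx) (parSymY x.toKIdx) (GpPhysY x.toKIdx (parSymY x.toKIdx)) ∧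
      (lettersYOfRecordV10K N θ Mstar 𝔯 x).QGQinv =
        QGQinvQY x.toKIdx (qKnitOfRecord N θ x.toKIdx) (qsKnitOfRecord N θ x.toKIdx) (parSymY x.toKIdx) (GpPhysY x.toKIdx (parSymY x.toKIdx)) ∧
      (lettersYOfRecordV10K N θ Mstar 𝔯 x).H =
        HDQY x.toKIdx (qKnitOfRecord N θ x.toKIdx) (qsKnitOfRecord N θ x.toKIdx) (parSymY x.toKIdx) (GpPhysY x.toKIdx (parSymY x.toKIdx)) ∧
      (lettersYOfRecordV10K N θ Mstar 𝔯 x).G₁ =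
        G1QY x.toKIdx (qKnitOfRecord N θ x.toKIdx) (qsKnitOfRecord N θ x.toKIdx) (parSymY x.toKIdx) (GpPhysY x.toKIdx (parSymY x.toKIdx))
          (𝔯 x).Δ2 ∧
      (lettersYOfRecordV10K N θ Mstar 𝔯 x).QG1Qinv =
        QG1QinvQY x.toKIdx (qKnitOfRecord N θ x.toKIdx) (qsKnitOfRecord N θ x.toKIdx) (parSymY x.toKIdx) (GpPhysY x.toKIdx (parSymY x.toKIdx))
          (𝔯 x).Δ2 ∧
      (lettersYOfRecordV10K N θ Mstar 𝔯 x).H₁ =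
        H1QY x.toKIdx (qKnitOfRecord N θ x.toKIdx) (qsKnitOfRecord N θ x.toKIdx) (parSymY x.toKIdx) (GpPhysY x.toKIdx (parSymY x.toKIdx))
          (𝔯 x).Δ2 ∧
      (lettersYOfRecordV10K N θ Mstar 𝔯 x).GG =
        GGQY x.toKIdx (qKnitOfRecord N θ x.toKIdx) (qsKnitOfRecord N θ x.toKIdx) (parSymY x.toKIdx) (GpPhysY x.toKIdx (parSymY x.toKIdx))
          (𝔯 x).Δ2 ∧
      (lettersYOfRecordV10K N θ Mstar 𝔯 x).GA =
        GAQY x.toKIdx (qKnitOfRecord N θ x.toKIdx) (qsKnitOfRecord N θ x.toKIdx) (parSymY x.toKIdx) (GpY x.toKIdx (parSymY x.toKIdx)) :=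
  ⟨rfl, rfl, rfl, rfl, rfl, rfl, rfl, rfl⟩

/-- ★ the knit record's `GA` is ALSO the composite fed `G′_phys`. [cite: Balaban1985BackgroundPropagators, (3.26)–(3.27) p.395, (3.25) p.394] -/
theorem lettersYOfRecordV10K_GA_phys (x : MemberY θ.d₆ θ.ℓ₆ θ.hd' θ.hL' θ.b₀ θ.b₁ Mstar) :
    (lettersYOfRecordV10K N θ Mstar 𝔯 x).GA =
      GAQY x.toKIdx (qKnitOfRecord N θ x.toKIdx) (qsKnitOfRecord N θ x.toKIdx) (parSymY x.toKIdx) (GpPhysY x.toKIdx (parSymY x.toKIdx)) :=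
  lettersYOfRecordV10_GA_phys N θ Mstar (qKnitOfRecord N θ) (qsKnitOfRecord N θ) (qKnitOfRecord_flat N θ) (qsKnitOfRecord_flat N θ) 𝔯 x

variable {G : Subgroup (Matrix (Fin N) (Fin N) ℂ)ˣ}

/-- ★★★ **THE KNIT RECORD'S `GD` IS SYMMETRIC AT EVERY `G`-VALUED CONFIGURATION, `G ≤ U(N)`** — no pair hypothesis left (the knit pair is adjoint by construction).
[cite: Balaban1985BackgroundPropagators, (3.122)–(3.123) p.420, (3.35) p.396] [cite: Balaban1985Averaging, (15) p.19] -/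
theorem lettersYOfRecordV10K_GD_isSymmTr (hG : G ≤ B7Prop2Explicit.unitaryUnits (Matrix (Fin N) (Fin N) ℂ))
    (x : MemberY θ.d₆ θ.ℓ₆ θ.hd' θ.hL' θ.b₀ θ.b₁ Mstar) {U : CfgY (Matrix (Fin N) (Fin N) ℂ) x.toKIdx} (hU : ∀ μ z, U μ z ∈ G) :
    IsSymmTr (fun _ => (1 : ℝ)) ((lettersYOfRecordV10K N θ Mstar 𝔯 x).GD U) :=
  lettersYOfRecordV10_GD_isSymmTr N θ Mstar (qKnitOfRecord N θ) (qsKnitOfRecord N θ) (qKnitOfRecord_flat N θ) (qsKnitOfRecord_flat N θ) 𝔯 hG x hU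
    (isAdjTr_qKnitOfRecord x.toKIdx U)

/-- ★★★ **THE CERTIFICATE's `hsymD` AT THE KNIT RECORD** (`GD ∧ G₁ ∧ GG` symmetric at special-unitary configurations) from the ONE displayed hypothesis on the
residual family — the adjointness of the knit pair DISCHARGED. [cite: Balaban1985BackgroundPropagators, (3.122) p.420, (3.128) p.421, (3.153) p.426, (3.35) p.396] [cite: Balaban1985Averaging, (15) p.19] -/
theorem lettersYOfRecordV10K_symmDG₁GG
    (hΔ2 : ∀ (x : MemberY θ.d₆ θ.ℓ₆ θ.hd' θ.hL' θ.b₀ θ.b₁ Mstar) (U : CfgY (Matrix (Fin N) (Fin N) ℂ) x.toKIdx), (∀ μ z, U μ z ∈ specialUnitaryUnits (Fin N)) →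
      IsSymmTr (fun _ => (1 : ℝ)) ((𝔯 x).Δ2 U)) :
    ∀ (x : MemberY θ.d₆ θ.ℓ₆ θ.hd' θ.hL' θ.b₀ θ.b₁ Mstar) (U : CfgY (Matrix (Fin N) (Fin N) ℂ) x.toKIdx), (∀ μ z, U μ z ∈ specialUnitaryUnits (Fin N)) →
      IsSymmTr (fun _ => (1 : ℝ)) ((lettersYOfRecordV10K N θ Mstar 𝔯 x).GD U) ∧ IsSymmTr (fun _ => (1 : ℝ)) ((lettersYOfRecordV10K N θ Mstar 𝔯 x).G₁ U) ∧
        IsSymmTr (fun _ => (1 : ℝ)) ((lettersYOfRecordV10K N θ Mstar 𝔯 x).GG U) :=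
  lettersYOfRecordV10_symmDG₁GG N θ Mstar (qKnitOfRecord N θ) (qsKnitOfRecord N θ) (qKnitOfRecord_flat N θ) (qsKnitOfRecord_flat N θ) 𝔯
    (fun x U _ => isAdjTr_qKnitOfRecord x.toKIdx U) hΔ2

/-- ★★ **THE UNIT `(Q G₁ Q†)(U)` AT THE KNIT RECORD** from `Δ⁽¹⁾(U) > 0` and «`QknitY(U)` onto» (the certificate's `hUQ`; adjointness by construction).
[cite: Balaban1985BackgroundPropagators, (3.132) p.422, (3.128) p.421, (3.138) p.423] [cite: Balaban1985Averaging, (15) p.19] -/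
theorem lettersYOfRecordV10K_isUnit_QGQOfQY_G₁ (x : MemberY θ.d₆ θ.ℓ₆ θ.hd' θ.hL' θ.b₀ θ.b₁ Mstar) {U : CfgY (Matrix (Fin N) (Fin N) ℂ) x.toKIdx}
    (hsurj : Function.Surjective (qKnitOfRecord N θ x.toKIdx U))
    (hΔ1 : PosDefTr (fun _ => (1 : ℝ)) (deltaOneQY x.toKIdx (qKnitOfRecord N θ x.toKIdx) (qsKnitOfRecord N θ x.toKIdx) (parSymY x.toKIdx)
      (GpPhysY x.toKIdx (parSymY x.toKIdx)) (𝔯 x).Δ2 U)) :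
    IsUnit (QGQOfQY x.toKIdx (qKnitOfRecord N θ x.toKIdx) (qsKnitOfRecord N θ x.toKIdx) (lettersYOfRecordV10K N θ Mstar 𝔯 x).G₁ U) :=
  lettersYOfRecordV10_isUnit_QGQOfQY_G₁_of_surjective N θ Mstar (qKnitOfRecord N θ) (qsKnitOfRecord N θ) (qKnitOfRecord_flat N θ)
    (qsKnitOfRecord_flat N θ) 𝔯 x (isAdjTr_qKnitOfRecord x.toKIdx U) hsurj hΔ1

/-- ★ the same from the regime law (L2) «`Q(U)` onto on the regime `𝓡`» (`IsOntoOnQ`) at a configuration of the regime.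
[cite: Balaban1985BackgroundPropagators, (3.132) p.422, (3.35) p.396] [cite: Balaban1985Averaging, (15) p.19] -/
theorem lettersYOfRecordV10K_isUnit_QGQOfQY_G₁_of_isOntoOnQ (x : MemberY θ.d₆ θ.ℓ₆ θ.hd' θ.hL' θ.b₀ θ.b₁ Mstar)
    {𝓡 : RegimeY (Matrix (Fin N) (Fin N) ℂ) x.toKIdx} (honto : IsOntoOnQ 𝓡 (qKnitOfRecord N θ x.toKIdx)) {U : CfgY (Matrix (Fin N) (Fin N) ℂ) x.toKIdx}
    (hU : 𝓡 U)
    (hΔ1 : PosDefTr (fun _ => (1 : ℝ)) (deltaOneQY x.toKIdx (qKnitOfRecord N θ x.toKIdx) (qsKnitOfRecord N θ x.toKIdx) (parSymY x.toKIdx)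
      (GpPhysY x.toKIdx (parSymY x.toKIdx)) (𝔯 x).Δ2 U)) :
    IsUnit (QGQOfQY x.toKIdx (qKnitOfRecord N θ x.toKIdx) (qsKnitOfRecord N θ x.toKIdx) (lettersYOfRecordV10K N θ Mstar 𝔯 x).G₁ U) :=
  lettersYOfRecordV10K_isUnit_QGQOfQY_G₁ N θ Mstar 𝔯 x (honto U hU) hΔ1

/-- the [B9] bundle of record at the `ν`-read knit instance. [cite: Balaban1985BackgroundPropagators, Thms 3.1–3.15 pp.397–432, bookkeeping] -/
theorem Y9OfRecord_opsYNuStOfRecordV10KE :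
    Y9OfRecord N θ Mstar (opsYNuStOfRecordV10KE N θ Mstar 𝔯 𝔢 𝔴 𝔈) =
      carriersY θ.d₆ θ.ℓ₆ θ.hd' θ.hL' θ.b₀ θ.b₁ Mstar (Matrix (Fin N) (Fin N) ℂ) (specialUnitaryUnits (Fin N)) (opsYNuStOfRecordV10KE N θ Mstar 𝔯 𝔢 𝔴 𝔈) :=
  rfl

/-- the [B9] bundle of record at the plain knit instance. [cite: Balaban1985BackgroundPropagators, Thms 3.1–3.15 pp.397–432, bookkeeping] -/
theorem Y9OfRecord_opsYStOfRecordV10KE :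
    Y9OfRecord N θ Mstar (opsYStOfRecordV10KE N θ Mstar 𝔯 𝔢 𝔴 𝔈) =
      carriersY θ.d₆ θ.ℓ₆ θ.hd' θ.hL' θ.b₀ θ.b₁ Mstar (Matrix (Fin N) (Fin N) ℂ) (specialUnitaryUnits (Fin N)) (opsYStOfRecordV10KE N θ Mstar 𝔯 𝔢 𝔴 𝔈) :=
  rfl

/-- ★ ROWS 24–26 at the `ν`-read knit instance: `Ck` = the STAR `C^{(k)}(Λ; U)` over the KNIT letters of record, `GivenBy3185`, `HasRWExpC`, and row 26's two kernels =
the `ν`-readings of `(QG̃Q†)⁻¹ ∕ (QG₁Q†)⁻¹` OVER THE KNIT PAIR fed `G′_phys` (`rfl`). [cite: Balaban1985BackgroundPropagators, Thm 3.15 (3.185)–(3.187) p.432, (3.132) p.422, (3.157)–(3.158) p.428] [cite: Balaban1985Averaging, (15) p.19] -/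
theorem opsYNuStOfRecordV10KE_sectE (x : MemberY θ.d₆ θ.ℓ₆ θ.hd' θ.hL' θ.b₀ θ.b₁ Mstar) :
    (opsYNuStOfRecordV10KE N θ Mstar 𝔯 𝔢 𝔴 𝔈 x).Ck =
        siteKernelOfOp x.toKIdx (bg9Y (Matrix (Fin N) (Fin N) ℂ) (specialUnitaryUnits (Fin N)) x) (fun U => U)
          (CkStY x (lettersYOfRecordV10K N θ Mstar 𝔯 x) (𝔢 x)) id id ∧
      (opsYNuStOfRecordV10KE N θ Mstar 𝔯 𝔢 𝔴 𝔈 x).GivenBy3185 = givenBy3185stY x (lettersYOfRecordV10K N θ Mstar 𝔯 x) (𝔢 x) ∧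
      (opsYNuStOfRecordV10KE N θ Mstar 𝔯 𝔢 𝔴 𝔈 x).HasRWExpC = hasRWExpCY (𝔴 x) ∧
      (opsYNuStOfRecordV10KE N θ Mstar 𝔯 𝔢 𝔴 𝔈 x).QGQinv =
        siteKernelOfOpNu x.toKIdx (bg9Y (Matrix (Fin N) (Fin N) ℂ) (specialUnitaryUnits (Fin N)) x) (fun U => U) (nuY (θ.d₆ + 1) x.toKIdx)
          (QGQinvQY x.toKIdx (qKnitOfRecord N θ x.toKIdx) (qsKnitOfRecord N θ x.toKIdx) (parSymY x.toKIdx) (GpPhysY x.toKIdx (parSymY x.toKIdx))) ∧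
      (opsYNuStOfRecordV10KE N θ Mstar 𝔯 𝔢 𝔴 𝔈 x).QG1Qinv =
        siteKernelOfOpNu x.toKIdx (bg9Y (Matrix (Fin N) (Fin N) ℂ) (specialUnitaryUnits (Fin N)) x) (fun U => U) (nuY (θ.d₆ + 1) x.toKIdx)
          (QG1QinvQY x.toKIdx (qKnitOfRecord N θ x.toKIdx) (qsKnitOfRecord N θ x.toKIdx) (parSymY x.toKIdx) (GpPhysY x.toKIdx (parSymY x.toKIdx))
            (𝔯 x).Δ2) := ⟨rfl, rfl, rfl, rfl, rfl⟩

variable (𝔢₀ : SectEY N θ Mstar)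

/-- ★★★ **ROW 24 AT THE `ν`-READ KNIT RECORD `opsYNuStOfRecordV10KE … 𝔯 (sectEStYOfRecordV7 … 𝔢₀) 𝔴 𝔈` OVER `bg9Y ∕ c35Y`** from the three displayed conjuncts at
the knit letters of record, locality PROVED. [cite: Balaban1985BackgroundPropagators, Thm 3.15 (3.185)–(3.187) p.432, (3.157) p.428] [cite: Balaban1985Averaging, (15) p.19] -/
theorem t315_opsYNuStOfRecordV10KE_sectEStYOfRecordV7_of_3185_on {a₀ δ₁ B₁ : ℝ} (ha₀ : 0 < a₀) (hδ₁ : 0 < δ₁) (hB₁ : 0 < B₁)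
    (h : ∀ (x : MemberY θ.d₆ θ.ℓ₆ θ.hd' θ.hL' θ.b₀ θ.b₁ Mstar) (α₀ : ℝ), 0 < α₀ → (geo9Y x).M * α₀ ≤ a₀ →
      ∀ U : (bg9Y (Matrix (Fin N) (Fin N) ℂ) (specialUnitaryUnits (Fin N)) x).Cfg,
        (bg9Y (Matrix (Fin N) (Fin N) ℂ) (specialUnitaryUnits (Fin N)) x).Reg335 c35Y α₀ U →
        (bg9Y (Matrix (Fin N) (Fin N) ℂ) (specialUnitaryUnits (Fin N)) x).Reg336 c35Y α₀ U →
          givenBy3185stY x (lettersYOfRecordV10K N θ Mstar 𝔯 x) (sectEStYOfRecordV7 N θ Mstar 𝔢₀ x) U ∧ hasRWExpCY (𝔴 x) U δ₁ ∧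
            DecayMidOnStY x (lettersYOfRecordV10K N θ Mstar 𝔯 x) (sectEStYOfRecordV7 N θ Mstar 𝔢₀ x) B₁ U δ₁) :
    B9.Thm315FullPrinted c35Y geo9Y (bg9Y (Matrix (Fin N) (Fin N) ℂ) (specialUnitaryUnits (Fin N)))
      (fun x => (opsYNuStOfRecordV10KE N θ Mstar 𝔯 (sectEStYOfRecordV7 N θ Mstar 𝔢₀) 𝔴 𝔈 x).Ck) inΛY unitDistY
      (fun x => (opsYNuStOfRecordV10KE N θ Mstar 𝔯 (sectEStYOfRecordV7 N θ Mstar 𝔢₀) 𝔴 𝔈 x).GivenBy3185)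
      (fun x => (opsYNuStOfRecordV10KE N θ Mstar 𝔯 (sectEStYOfRecordV7 N θ Mstar 𝔢₀) 𝔴 𝔈 x).HasRWExpC) :=
  t315_opsYSectESt_sectEStYOfRecordV7_of_3185_on N θ Mstar 𝔢₀ (opsYS349NuOfLetters N θ Mstar (lettersYOfRecordV10K N θ Mstar 𝔯) 𝔈)
    (lettersYOfRecordV10K N θ Mstar 𝔯) 𝔴 ha₀ hδ₁ hB₁ h

variable {R₁ R₂ : RegFamY θ.d₆ θ.ℓ₆ θ.hd' θ.hL' θ.b₀ θ.b₁ Mstar (Matrix (Fin N) (Fin N) ℂ)}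

/-- ★★★ **ROW 24 AT THE `ν`-READ KNIT RECORD OVER THE CLASS-PARAMETRIC CARRIER `bg9YR … R₁ R₂` AT GENERIC `c`** (special-unitary member family `hGR`) from the
three displayed conjuncts at the knit letters of record, locality PROVED — the knit twin of the certificate's `have t315 := …_onR …` step.
[cite: Balaban1985BackgroundPropagators, Thm 3.15 (3.185)–(3.187) p.432, (3.157) p.428, (3.35)–(3.36) p.396; Balaban1984PropagatorsII, (2.3) p.224] [cite: Balaban1985Averaging, (15) p.19] -/
theorem t315_opsYNuStOfRecordV10KE_sectEStYOfRecordV7_of_3185_onR (hGR : MemOfFam (specialUnitaryUnits (Fin N)) R₁) {c a₀ δ₁ B₁ : ℝ}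
    (ha₀ : 0 < a₀) (hδ₁ : 0 < δ₁) (hB₁ : 0 < B₁)
    (h : ∀ (x : MemberY θ.d₆ θ.ℓ₆ θ.hd' θ.hL' θ.b₀ θ.b₁ Mstar) (α₀ : ℝ), 0 < α₀ → (geo9Y x).M * α₀ ≤ a₀ →
      ∀ U : (bg9YR (Matrix (Fin N) (Fin N) ℂ) (specialUnitaryUnits (Fin N)) R₁ R₂ x).Cfg,
        (bg9YR (Matrix (Fin N) (Fin N) ℂ) (specialUnitaryUnits (Fin N)) R₁ R₂ x).Reg335 c α₀ U →
        (bg9YR (Matrix (Fin N) (Fin N) ℂ) (specialUnitaryUnits (Fin N)) R₁ R₂ x).Reg336 c α₀ U →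
          givenBy3185stY x (lettersYOfRecordV10K N θ Mstar 𝔯 x) (sectEStYOfRecordV7 N θ Mstar 𝔢₀ x) U ∧ hasRWExpCY (𝔴 x) U δ₁ ∧
            DecayMidOnStY x (lettersYOfRecordV10K N θ Mstar 𝔯 x) (sectEStYOfRecordV7 N θ Mstar 𝔢₀ x) B₁ U δ₁) :
    B9.Thm315FullPrinted c geo9Y (bg9YR (Matrix (Fin N) (Fin N) ℂ) (specialUnitaryUnits (Fin N)) R₁ R₂)
      (fun x => siteKernelR R₁ R₂ (opsYNuStOfRecordV10KE N θ Mstar 𝔯 (sectEStYOfRecordV7 N θ Mstar 𝔢₀) 𝔴 𝔈 x).Ck) inΛY unitDistY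
      (fun x => (opsYNuStOfRecordV10KE N θ Mstar 𝔯 (sectEStYOfRecordV7 N θ Mstar 𝔢₀) 𝔴 𝔈 x).GivenBy3185)
      (fun x => (opsYNuStOfRecordV10KE N θ Mstar 𝔯 (sectEStYOfRecordV7 N θ Mstar 𝔢₀) 𝔴 𝔈 x).HasRWExpC) :=
  t315_opsYSectESt_sectEStYOfRecordV7_of_3185_onR N θ Mstar 𝔢₀ hGR (opsYS349NuOfLetters N θ Mstar (lettersYOfRecordV10K N θ Mstar 𝔯) 𝔈)
    (lettersYOfRecordV10K N θ Mstar 𝔯) 𝔴 ha₀ hδ₁ hB₁ h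

/-- ★★ the same over the class-parametric carrier at the PLAIN knit record. [cite: Balaban1985BackgroundPropagators, Thm 3.15 (3.185)–(3.187) p.432, (3.157) p.428, (3.35)–(3.36) p.396] [cite: Balaban1985Averaging, (15) p.19] -/
theorem t315_opsYStOfRecordV10KE_sectEStYOfRecordV7_of_3185_onR (hGR : MemOfFam (specialUnitaryUnits (Fin N)) R₁) {c a₀ δ₁ B₁ : ℝ}
    (ha₀ : 0 < a₀) (hδ₁ : 0 < δ₁) (hB₁ : 0 < B₁)
    (h : ∀ (x : MemberY θ.d₆ θ.ℓ₆ θ.hd' θ.hL' θ.b₀ θ.b₁ Mstar) (α₀ : ℝ), 0 < α₀ → (geo9Y x).M * α₀ ≤ a₀ →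
      ∀ U : (bg9YR (Matrix (Fin N) (Fin N) ℂ) (specialUnitaryUnits (Fin N)) R₁ R₂ x).Cfg,
        (bg9YR (Matrix (Fin N) (Fin N) ℂ) (specialUnitaryUnits (Fin N)) R₁ R₂ x).Reg335 c α₀ U →
        (bg9YR (Matrix (Fin N) (Fin N) ℂ) (specialUnitaryUnits (Fin N)) R₁ R₂ x).Reg336 c α₀ U →
          givenBy3185stY x (lettersYOfRecordV10K N θ Mstar 𝔯 x) (sectEStYOfRecordV7 N θ Mstar 𝔢₀ x) U ∧ hasRWExpCY (𝔴 x) U δ₁ ∧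
            DecayMidOnStY x (lettersYOfRecordV10K N θ Mstar 𝔯 x) (sectEStYOfRecordV7 N θ Mstar 𝔢₀ x) B₁ U δ₁) :
    B9.Thm315FullPrinted c geo9Y (bg9YR (Matrix (Fin N) (Fin N) ℂ) (specialUnitaryUnits (Fin N)) R₁ R₂)
      (fun x => siteKernelR R₁ R₂ (opsYStOfRecordV10KE N θ Mstar 𝔯 (sectEStYOfRecordV7 N θ Mstar 𝔢₀) 𝔴 𝔈 x).Ck) inΛY unitDistY
      (fun x => (opsYStOfRecordV10KE N θ Mstar 𝔯 (sectEStYOfRecordV7 N θ Mstar 𝔢₀) 𝔴 𝔈 x).GivenBy3185)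
      (fun x => (opsYStOfRecordV10KE N θ Mstar 𝔯 (sectEStYOfRecordV7 N θ Mstar 𝔢₀) 𝔴 𝔈 x).HasRWExpC) :=
  t315_opsYSectESt_sectEStYOfRecordV7_of_3185_onR N θ Mstar 𝔢₀ hGR (opsYS349OfLetters N θ Mstar (lettersYOfRecordV10K N θ Mstar 𝔯) 𝔈)
    (lettersYOfRecordV10K N θ Mstar 𝔯) 𝔴 ha₀ hδ₁ hB₁ h

end RecordKnit

end Literature.MathematicalPhysics.QuantumFieldTheory.Balaban1983to89.Node00

end
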